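import Literature.MathematicalPhysics.QuantumFieldTheory.Balaban1983to89.B9Eq370Expansion
import Literature.MathematicalPhysics.QuantumFieldTheory.Balaban1983to89.B9Eq352ScalarFluct
import Literature.MathematicalPhysics.QuantumFieldTheory.Balaban1983to89.B9Eq310Hermitian

/-!
# `Balaban1983to89.B9Eq3117Current` — B9 p. 395, (3.28)–(3.30), and pp. 418–419, (3.116)–(3.117): gauge transformations of
# configurations in the exact-background lattice vocabulary of `B9Eq39Adjoint`; the EXACT gauge invariance of `A^η` (3.29) and
# covariance of `J`, `⟨A,ΔA⟩` (3.30); the second-order data of `U′ᵘ_b = e^{iλ(b₋)}e^{iηA(b)}e^{−iR_bλ(b₊)}` (3.116); and the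
# CURRENT CONSERVATION `D*J = 0`, `⟨Dλ, J⟩ = 0` of (3.117) — all kernel-checked; v2 (§7): the quadratic-form identity of (3.117),
# typed in v1 as `Eq3117QuadShift`, is now PROVED (`Eq3117QuadShift_holds`) by the printed route, plaquette by plaquette; v3 adds
# its corollary (3.119)–(3.120) (`eq3120`), the operator forms of (3.30) (`deltaOp_gaugeTr`) and (3.31) (`siteLap_gaugeTr`)

statement-level skeleton of published theorems with citation tags; proofs where landed; nothing here is a claim about the Yang–Mills mass gap

CITATION HEADER (lean-in-tree rule).  Cell `lit-balaban` (mega-formalization of Bałaban CMP 1983–89), reader/typer seat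
`lit-balaban-r06` (rows `B9.Eq3.28`, `B9.Eq3.116` of `run/shared/lean/pub/lit-balaban/lit-balaban-r06/ROWS-B9.md`).  Source:
T. Bałaban, *Propagators for lattice gauge theories in a background field*, Commun. Math. Phys. **99** (1985) 389–434
[Balaban1985BackgroundPropagators] (cell paper B9; journal page = PDF page + 388), p. 395 [PDF 7] and pp. 418–419 [PDF 30–31],
quoted from the text layer of the held PDF (`paper:balaban1985-cmp99-background-propagators`) and the page renders
`b2b-balaban-ref1/pages/1985-cmp99-background-propagators/…-p030-x4.png`, `…-p031-x4.png` READ AS IMAGES by this seat (2026-08-20).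

HONEST FRAMING (cell charter).  The cell types and, where cheap, proves the published statements of Bałaban's series; nothing
here bears on the continuum limit or the Clay problem.  THIS FILE is finite non-commutative algebra on a finite lattice with an
EXACT background of units: no estimates, no propagators, no renormalization step.  Value = kernel certificates of located printed
identities ((3.29), (3.30), both identities of (3.117)) in the vocabulary the other `B9Eq3…` files already use, and the typed
objects `U^u`, `R(u)A`, `U′ᵘ`; NOT summit progress.

ABSOLUTE RULE.  No internally-minted statement enters as a cited fact.  Every `theorem` below is PROVED (tags `[folklore]`); the
`[cite: …]` tags say WHICH PRINTED DISPLAY a definition or a proved statement transcribes.  The one `def … : Prop` (§5,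
`Eq3117QuadShift`, the printed second identity of (3.117) under B9 §3's standing hypotheses — typed in v1, restated with those
hypotheses as antecedents in v3) is DISCHARGED in §7 by the closed theorem `Eq3117QuadShift_holds`.

WHAT IS IN PRINT («…» verbatim up to notation).
* p. 395 [PDF 7]: «the gauge invariance of the action (3.1) implies that if we make the transformations U → U^u, U′ → R(u)U′,
  (3.28) where U^u(x, x′) = u(x)U(x, x′)u⁻¹(x′), (R(u)U′)(x, x′) = R(u(x))U′(x, x′), then A^η(R(u)U′U^u) = A^η((U′U)^u) = A^η(U′U).
  (3.29)  Of course R(u(x)) exp iηA(x, x′) = exp iηR(u(x))A(x, x′) and R(u)A is linear in A, hence expanding both sides of the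
  above equality in A we get a sequence of equalities between homogeneous polynomials of the same order. Taking the polynomials
  of first and second order we get ⟨R(u)A, J^u⟩ = ⟨A, J⟩, ⟨R(u)A, Δ^η(U^u)R(u)A⟩ = ⟨A, Δ^η(U)A⟩, (3.30) or J^u = R(u)J,
  Δ^η(U^u) = R(u)Δ^η(U)R(u⁻¹).»
* p. 418 [PDF 30]: «We use the fact that a linear gauge transformation defined by λ is a linear part of the transformation
  U′ → U′ᵘ defined by u = e^{iλ}»; «Let us consider how the basic quadratic form ⟨A, ΔA⟩ changes under the gauge transformations.
  We use again the non-linear gauge transformations U′ → U′ᵘ and the identity A^η(U′ᵘU) = A^η(U′U). Now we need expansions up to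
  second order in A, λ. Let us write an expansion of U′ᵘ, U′ = e^{iηA}, u = e^{iλ}:
  (1/iη) log U′ᵘ_b = (1/iη) log u(b₋)U′_b R_b u⁻¹(b₊) = (1/iη) log e^{iλ(b₋)}e^{iηA(b)}e^{−iR_bλ(b₊)}
  = A(b) − (Dλ)(b) + ½i[λ(b₋), A(b)] − ½i[A(b), R_bλ(b₊)] − ½η⁻¹i[λ(b₋), R_bλ(b₊)] + ⋯, (3.116)»
* p. 419 [PDF 31]: «the dots denote higher order terms. Expanding the both sides of the identity according to (3.12), and
  comparing terms of the same order, we get the identities ⟨Dλ, J⟩ = 0, or D*J = 0,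
  ⟨A − Dλ, Δ(A − Dλ)⟩ = ⟨A, ΔA⟩ − ⟨i[λ(b₋), A(b)] − i[A(b), R_bλ(b₊)] − i[λ(b₋), (Dλ)(b)], J⟩. (3.117)  The last equality can be
  interpreted as almost invariance of the quadratic form, the error terms are small because the function J = D*η⁻²Im ∂U is small,
  if U satisfies the condition (3.36).»

WHAT THIS FILE PROVES.  MODEL = that of `B9Eq39Adjoint` (sites `S`, directions `ι`, shifts `T μ : S ≃ S`, background
`U : ι → S → 𝔸ˣ` of arbitrary UNITS of a ring / complete normed ℂ-algebra `𝔸`, `R U X = UXU⁻¹`, tracial `τ` for «tr»,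
complexified `Re`/`Im`); where a plaquette has to CLOSE we assume the shifts commute (`hT`, the torus).
* §1 commuting shifts, backward form (`symm_symm_comm`).
* §2 **(3.117), first identity, PROVED EXACTLY**: `divB_J_eq_zero : D*J = 0` for the current `J = D^{η*}(η⁻² Im ∂U)` of (3.11),
  ANY background of units, any finite lattice with commuting shifts — mechanism `sum_sum_covDstar_covDstar_eq_zero`: in
  `Σ_μΣ_ν D*_μD*_ν F_{νμ}` the values at `x`, `x−e_μ`, `x−e_ν` cancel by antisymmetry of `F` and the two transports of `F(p)` from
  the far corner differ by `R(U(∂p))`, invisible to `F(p) = Im U(∂p)` (`R_imC_self`, `imC_plaqU_swap`); and its paired form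
  `bondPair_covDη_J : ⟨D^ηλ, J⟩ = 0` by the adjointness (3.8) (`B9Eq39Adjoint.sum_sum_covD_mul` BY NAME).  `covDη` = (3.3) with
  its `η⁻¹` as a bond function.
* §3 (3.28)–(3.30), PROVED EXACTLY: `gaugeTr` = «U^u(x,x′) = u(x)U(x,x′)u⁻¹(x′)», `rotB` = «(R(u)A)(b) = R(u(b₋))A(b)», `rotS`;
  covariance of every operator of (3.3)–(3.11): `plaqU_gaugeTr` (`U^u(∂p) = u(x)U(∂p)u(x)⁻¹`), `covD_gaugeTr`, `covDstar_gaugeTr`,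
  `curl_gaugeTr`, `divB_gaugeTr`, `divP_gaugeTr`, `lettersA_gaugeTr`, `commSum_map_R`; **(3.30)** `J_gaugeTr : J^u = R(u)J`,
  `bondPair_J_gaugeTr : ⟨R(u)A, J^u⟩ = ⟨A,J⟩`, `deltaPrime_gaugeTr`, `hessPair_gaugeTr : ⟨R(u)A, Δ^η(U^u)R(u)A⟩ = ⟨A, Δ^η(U)A⟩`;
  **(3.29)** `action_gaugeTr : A^η(U^u) = A^η(U)` and, with `fluct_rotB` («R(u(x)) exp iηA = exp iηR(u(x))A») and
  `prodCfg_gaugeTr : (R(u)U′)U^u = (U′U)^u`, `action_prodCfg_gaugeTr : A^η(R(u)U′U^u) = A^η(U′U)`.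
* §4 (3.116): `expCfg` = «u = e^{iλ}», `gaugeFl` = «U′ᵘ_b = u(b₋)U′_b R_b u⁻¹(b₊)» with `gaugeTr_mul : (U′U)^u = U′ᵘ·U`,
  `gaugeFl_fluct : U′ᵘ_b = e^{iλ(b₋)}e^{iηA(b)}e^{−iR_bλ(b₊)}` (the three letters `letters3`), and the printed expansion data:
  `sum_letters3` (first order `iη(A − Dλ)(b)`), `commSum_letters3` (second order `2iη·bch2`, `bch2` = the printed
  `½i[λ(b₋),A(b)] − ½i[A(b),R_bλ(b₊)] − ½η⁻¹i[λ(b₋),R_bλ(b₊)]`), `ad_covDη` (the last bracket of (3.116) IS the last bracket of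
  (3.117)), `val_gaugeFl_fluct` ((3.116) to second order in PRODUCT form, remainder `B9Eq37Insertion.rem`, third order by
  `norm_rem_letters3_le`).  The print's left-hand side `(1/iη) log U′ᵘ_b` is not typed (no Banach-algebra logarithm in Mathlib):
  since `log P = (P−1) − ½(P−1)² + O(3)`, the certified first/second-order data of the product ARE the printed coefficients.
* §5 (3.117), second identity: `Eq3117QuadShift T U η d τ : Prop`, the printed identity with `⟨A,ΔA⟩ = B9Eq39Adjoint.hessPair`,
  `J`, `D^η` and the bracket `shiftJ` (`two_smul_bch2 : 2·bch2 = shiftJ`), with the standing hypotheses (commuting shifts, tracial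
  `τ`, `η ≠ 0`) as antecedents (v3) — PROVED in §7 (`Eq3117QuadShift_holds`, closed).  (Seat record: transcribed
  into floating point with the tree's definitions it also holds to rounding for random invertible 2×2 backgrounds on small tori, with
  exactly the printed signs and no other sign pattern.)
* §6 sanity examples (trivial background: `J = 0`; pure gauge `U^u(b) = u(b₋)u(b₊)⁻¹`).
* §7 **(3.117), SECOND IDENTITY, PROVED** (`Eq3117QuadShift_holds`, every `d`, `η ≠ 0`, continuous tracial `τ`, commuting shifts,
  ARBITRARY background of units) BY THE PRINTED ROUTE, plaquette by plaquette: (§7.1) the plaquette `word` of a configuration whose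
  fluctuation is a product of exponentials on every bond, `wil_plaqU_holU_mul` ((3.1) for list-valued fluctuations), its letter sum
  and ordered commutator sum (`sum_word`, `commSum_word`); (§7.2) the coefficients `coef1`, `coef2`, `coef3` of
  `B9Eq37Insertion.wil_holonomy_mul`, their homogeneity along a ray and the uniform third-order bound `norm_coef3_smul_le`, and
  «comparing terms of the same order» = `eq_zero_of_norm_le_cube` (‖ta + t²b‖ ≤ Kt³ on (0,1] ⇒ a = b = 0) ⇒ `coef_eq_of_wil_eq`;
  (§7.3) `coef1_letters`/`coef2_letters`: for the one-letter word of a bond function `B` the weighted coefficients ARE the (3.11) and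
  ½·(3.10) plaquette summands (from `B9Eq39Adjoint.summand_split`), `sum_coef2_letters : Σ_p η^{d−4}coef2 = ½⟨B, Δ^η(U)B⟩`;
  `coef2_word_letters3`: the three-letter word of `U′ᵘ` ((3.116): `sum_letters3`, `commSum_letters3`) has the letter sum of the
  one-letter word of `A − Dλ` and its second coefficient shifted by `η·τ((D_U bch2)(p)·Im U(∂p))`, which sums to `⟨bch2, J⟩`;
  (§7.4) `wil_word_letters3_eq`: gauge invariance (3.29) per plaquette along `t ↦ (tA, tλ)` (`gaugeTr_mul`, `gaugeFl_fluct`,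
  `prodCfg`, `plaqU_gaugeTr`, `wil_conj`, `wil_plaqU_prodCfg`), hence equal second coefficients (`coef2_word_letters3_eq_coef2_letters`),
  hence `½⟨A − Dλ, Δ(A − Dλ)⟩ + ⟨bch2, J⟩ = ½⟨A, ΔA⟩` for `d ≥ 4` (`eq3117QuadShift_of_le`) and, by homogeneity in `η^d`
  (`hessPair_pow`, `bondPair_pow`), for every `d`; `2·bch2 = shiftJ` closes it.

RELATED IN THE TREE, NOT DUPLICATED (searched 2026-08-20: `lean search gaugeTr|gaugeAct|"J_gauge"|divB_J`, grep `(3.11[67])`,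
`(3.2[89])`, `(3.30)` over `Balaban1983to89/`): `B9Eq333Cov` proves (3.30)–(3.34) as INTERTWINING consequences in an abstract
real-Hilbert model with (3.30)/(3.31) as HYPOTHESES (`h30`, `h31`) — here (3.29)/(3.30) are proved from the lattice definitions;
`B9Eq39Adjoint` has `J`, `hessPair`, `action`, `eq312` but no gauge transformations; `B9Eq352ScalarFluct`/`B9Eq370Expansion` expand
in the fluctuation `A`, not in a gauge parameter; `MassGapGaugeInvariantClass.gaugeTransformEquiv` is a measurable-equivalence on a
different (probability) model.  Nothing in the tree states or proves `D*J = 0` or types (3.116)/(3.117).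

* §7.5 **(3.119)–(3.120), PROVED** as the corollary of (3.117) at `λ = PA` for ANY map `P` from bond functions to site functions
  (print: `P = G′RD*`): `hessPi` = «⟨A,Δ_πA⟩ = ⟨A − DG′RD*A, Δ(A − DG′RD*A)⟩» (3.119), `deltaPiPrime` = «⟨A,Δ′_πA⟩» (3.120),
  `eq3120 : ⟨A,Δ_πA⟩ = ⟨A,ΔA⟩ − ⟨A,Δ′_πA⟩`.
* §7.6 **(3.31), operator form, PROVED**: `siteLap_gaugeTr : Δ^η_{U^u}(R(u)λ) = R(u)(Δ^η_Uλ)` for the covariant Laplace operator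
  `B9Eq352ScalarFluct.siteLap` (3.23), any background of units (no plaquette closes: no `hT`).
* §7.7 **(3.30), operator form, PROVED**: `deltaOp_gaugeTr : Δ^η(U^u)(R(u)A) = R(u)(Δ^η(U)A)` bond by bond for THE OPERATOR
  `B9Eq310Hermitian.deltaOp` of (3.10) (via `zP_gaugeTr`, `yP_gaugeTr`, `jordanF_gaugeTr`, `sgnSum_gaugeTr`, `commG_gaugeTr`,
  `divL_gaugeTr`, `deltaPrimeOp_gaugeTr`), commuting shifts.
NOT PROVED HERE, NOT CLAIMED: anything about `log` (the left-hand side of (3.116) is certified through the product's Taylor data);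
the smallness of `J` under (3.36); (3.118)–(3.120).  DIVERGENCES: unit lattice with scalar `η`-factors and complexified `Re`/`Im` as in `B9Eq39Adjoint`; arbitrary
units instead of `U(N)`; commuting shifts assumed exactly where print's torus is used.  NOT summit progress.
-/

noncomputable section

namespace Literature.MathematicalPhysics.QuantumFieldTheory.Balaban1983to89.B9Eq3117Current

open NormedSpace Complex
open Literature.MathematicalPhysics.QuantumFieldTheory.Balaban1983to89
open Literature.MathematicalPhysics.QuantumFieldTheory.Balaban1983to89.Beta.TransportVertices
open Literature.MathematicalPhysics.QuantumFieldTheory.Balaban1983to89.Beta.AdjointTransportJets (invPath invPath_cons invPath_nil)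
open Literature.MathematicalPhysics.QuantumFieldTheory.Balaban1983to89.Beta.BackgroundVertices (ad ad_apply ad_smul_left
  ad_smul_right ad_sub_left ad_sub_right ad_add_left ad_add_right ad_neg_left)
open Literature.MathematicalPhysics.QuantumFieldTheory.Balaban1983to89.B9Eq37Insertion
open Literature.MathematicalPhysics.QuantumFieldTheory.Balaban1983to89.B9Eq39Adjoint
open Literature.MathematicalPhysics.QuantumFieldTheory.Balaban1983to89.B9Eq369Small (plaqU_inv_val)

/-! ## §1  Commuting shifts: the torus hypothesis used by every CLOSED plaquette argument -/

section Shifts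

variable {S : Type*} {ι : Type*} (T : ι → Equiv.Perm S)

/-- On `T_η` the shifts `x ↦ x + ηe_μ` commute; the exact-background files need it only where a plaquette must CLOSE
(«z = y + e_ν = w + e_μ» for `p = ⟨x, y, z, w⟩`, p. 391).  Backward–backward form. [folklore]
[cite: Balaban1985BackgroundPropagators, p.391] -/
theorem symm_symm_comm (hT : ∀ μ ν x, T μ (T ν x) = T ν (T μ x)) (μ ν : ι) (x : S) :
    (T ν).symm ((T μ).symm x) = (T μ).symm ((T ν).symm x) := by
  apply (T μ).injective
  apply (T ν).injective
  rw [hT ν μ, Equiv.apply_symm_apply, Equiv.apply_symm_apply, Equiv.apply_symm_apply, Equiv.apply_symm_apply]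

end Shifts

/-! ## §2  (3.117), first identity: the current `J = D^{η*}η⁻² Im ∂U` is covariantly conserved, `D*J = 0`, exactly -/

section Current

variable {𝔸 : Type*} [Ring 𝔸] [Algebra ℂ 𝔸] {S : Type*} {ι : Type*}
variable (T : ι → Equiv.Perm S) (U : ι → S → 𝔸ˣ)

omit [Algebra ℂ 𝔸] in
/-- Reversing the orientation of a plaquette inverts its variable: `U(∂p_{νμ}(x)) = U(∂p_{μν}(x))⁻¹` ((3.5) p. 391). [folklore]
[cite: Balaban1985BackgroundPropagators, (3.5) p.391] -/
theorem plaqU_swap (μ ν : ι) (x : S) : plaqU T U ν μ x = (plaqU T U μ ν x)⁻¹ := by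
  simp only [plaqU, mul_inv_rev, inv_inv, mul_assoc]

/-- `Im U(∂p)` is ODD under orientation reversal. [folklore] [cite: Balaban1985BackgroundPropagators, (3.5) p.391, p.391] -/
theorem imC_plaqU_swap (μ ν : ι) (x : S) : imC (plaqU T U ν μ x) = -imC (plaqU T U μ ν x) := by
  rw [plaqU_swap, imC_inv]

/-- `Im W` commutes with `W`: `R(W)(Im W) = Im W` — the algebraic reason for `D*J = 0`. [folklore]
[cite: Balaban1985BackgroundPropagators, (3.117) p.419, p.391] -/
theorem R_imC_self (W : 𝔸ˣ) : R W (imC W) = imC W := by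
  rw [imC, R_smul, R_def, mul_sub, sub_mul, Units.mul_inv_cancel_right, Units.mul_inv, one_mul]

omit [Algebra ℂ 𝔸] in
/-- `D*_μ D*_ν G` EXPANDED: four transported values of `G` (at `x`, `x−e_μ`, `x−e_ν`, `x−e_μ−e_ν`). [folklore]
[cite: Balaban1985BackgroundPropagators, (3.8) p.392] -/
theorem covDstar_covDstar (μ ν : ι) (G : S → 𝔸) (x : S) :
    covDstar T U μ (covDstar T U ν G) x
      = R ((U μ ((T μ).symm x))⁻¹ * (U ν ((T ν).symm ((T μ).symm x)))⁻¹) (G ((T ν).symm ((T μ).symm x)))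
        - R (U μ ((T μ).symm x))⁻¹ (G ((T μ).symm x))
        - R (U ν ((T ν).symm x))⁻¹ (G ((T ν).symm x)) + G x := by
  simp only [covDstar, R_sub, B9Eq39Adjoint.R_mul]
  abel

/-- (3.3) with its `η⁻¹`: the covariant gradient `(D^η_U λ)(b) = η⁻¹(R(U(b))λ(b₊) − λ(b₋))` of a site function, as a bond
function. [folklore] [cite: Balaban1985BackgroundPropagators, (3.3) p.390] -/
def covDη (η : ℝ) (lam : S → 𝔸) : ι → S → 𝔸 := fun μ x => ((η : ℂ)⁻¹) • covD T U μ lam x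

/-- Unfolding `covDη`: `(D^η_U λ)_μ(x) = η⁻¹(D¹_{U,μ}λ)(x)`. [folklore] [cite: Balaban1985BackgroundPropagators, (3.3) p.390] -/
theorem covDη_apply (η : ℝ) (lam : S → 𝔸) (μ : ι) (x : S) :
    covDη T U η lam μ x = ((η : ℂ)⁻¹) • covD T U μ lam x := rfl

variable [Fintype ι]

/-- `D*` (3.8) is linear: scalar multiples. [folklore] [cite: Balaban1985BackgroundPropagators, (3.8) p.392] -/
theorem divB_smul (c : ℂ) (B : ι → S → 𝔸) (x : S) :
    divB T U (fun μ y => c • B μ y) x = c • divB T U B x := by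
  simp only [divB, Finset.smul_sum, ← covDstar_smul]
  rfl

omit [Algebra ℂ 𝔸] in
/-- `D*_μ` (3.8) is linear: finite sums. [folklore] [cite: Balaban1985BackgroundPropagators, (3.8) p.392] -/
theorem covDstar_sum (μ : ι) (g : ι → S → 𝔸) (x : S) :
    covDstar T U μ (fun y => ∑ ν, g ν y) x = ∑ ν, covDstar T U μ (g ν) x := by
  simp only [covDstar, R_def, Finset.mul_sum, Finset.sum_mul, Finset.sum_sub_distrib]

/-- An antisymmetric double sum over the directions vanishes (no `2`-torsion over `ℂ`). [folklore] — elementary API for D*D* = 0 behind (3.117). [cite: Balaban1985BackgroundPropagators, (3.117) p.419] -/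
private theorem sum_sum_eq_zero_of_antisymm (t : ι → ι → 𝔸) (ht : ∀ μ ν, t μ ν = -t ν μ) : ∑ μ, ∑ ν, t μ ν = 0 := by
  apply eq_zero_of_eq_neg_self (𝔸 := 𝔸)
  calc ∑ μ, ∑ ν, t μ ν = ∑ μ, ∑ ν, -t ν μ := Finset.sum_congr rfl fun μ _ => Finset.sum_congr rfl fun ν _ => ht μ ν
    _ = -∑ μ, ∑ ν, t ν μ := by simp only [Finset.sum_neg_distrib]
    _ = -∑ μ, ∑ ν, t μ ν := by rw [Finset.sum_comm]

/-- **THE MECHANISM OF `D*J = 0`** (exact background, any lattice with commuting shifts): for an antisymmetric plaquette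
function `F` whose value on `p` commutes with the holonomy `U(∂p)` — as `Im U(∂p)` does — the double covariant divergence
`Σ_μ Σ_ν D*_μ D*_ν F_{νμ}` vanishes: the terms at `x`, `x−e_μ`, `x−e_ν` cancel by antisymmetry alone, and the two transports of
`F(p)` from the far corner `x−e_μ−e_ν` differ exactly by `R(U(∂p))`, which `F(p)` does not see. [folklore]
[cite: Balaban1985BackgroundPropagators, (3.117) p.419, (3.8)–(3.9) p.392] -/
theorem sum_sum_covDstar_covDstar_eq_zero (hT : ∀ μ ν x, T μ (T ν x) = T ν (T μ x)) (F : ι → ι → S → 𝔸)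
    (hF : ∀ μ ν x, F ν μ x = -F μ ν x) (hcomm : ∀ μ ν z, R (plaqU T U μ ν z) (F ν μ z) = F ν μ z) (x : S) :
    ∑ μ, ∑ ν, covDstar T U μ (covDstar T U ν (F ν μ)) x = 0 := by
  simp only [covDstar_covDstar, Finset.sum_add_distrib, Finset.sum_sub_distrib]
  -- the far-corner terms: antisymmetric after moving `R(U(∂p))` through `F(p)`
  have h1 : ∑ μ, ∑ ν, R ((U μ ((T μ).symm x))⁻¹ * (U ν ((T ν).symm ((T μ).symm x)))⁻¹)
      (F ν μ ((T ν).symm ((T μ).symm x))) = 0 := by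
    apply sum_sum_eq_zero_of_antisymm
    intro μ ν
    set z := (T ν).symm ((T μ).symm x) with hz
    have hz' : (T μ).symm ((T ν).symm x) = z := (symm_symm_comm T hT μ ν x).symm
    have hxμ : (T μ).symm x = T ν z := by rw [hz, Equiv.apply_symm_apply]
    have hxν : (T ν).symm x = T μ z := by rw [← hz', Equiv.apply_symm_apply]
    rw [hz', hxμ, hxν]
    have hW : (U μ (T ν z))⁻¹ * (U ν z)⁻¹ = ((U ν (T μ z))⁻¹ * (U μ z)⁻¹) * plaqU T U μ ν z := by
      simp only [plaqU, mul_assoc, inv_mul_cancel_left]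
    rw [hW, B9Eq39Adjoint.R_mul, hcomm, hF ν μ z, R_neg, neg_neg]
  -- the two middle families cancel against each other after renaming the summation indices
  have h2 : ∑ μ, ∑ ν, R (U ν ((T ν).symm x))⁻¹ (F ν μ ((T ν).symm x))
      = -∑ μ, ∑ ν, R (U μ ((T μ).symm x))⁻¹ (F ν μ ((T μ).symm x)) := by
    rw [Finset.sum_comm, ← Finset.sum_neg_distrib]
    refine Finset.sum_congr rfl fun μ _ => ?_
    rw [← Finset.sum_neg_distrib]
    refine Finset.sum_congr rfl fun ν _ => ?_
    rw [hF ν μ, R_neg]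
  -- the base-point terms: antisymmetric
  have h4 : ∑ μ, ∑ ν, F ν μ x = 0 := sum_sum_eq_zero_of_antisymm _ fun μ ν => hF μ ν x
  rw [h1, h2, h4]
  abel

variable [LinearOrder ι]

/-- `D*(D*F) = 0` for such `F`, with `D*F` the plaquette adjoint (3.9) (first form; antisymmetry turns it into the last form).
[folklore] [cite: Balaban1985BackgroundPropagators, (3.9) p.392, (3.117) p.419] -/
theorem divB_divP_eq_zero (hT : ∀ μ ν x, T μ (T ν x) = T ν (T μ x)) (F : ι → ι → S → 𝔸)
    (hF : ∀ μ ν x, F ν μ x = -F μ ν x) (hcomm : ∀ μ ν z, R (plaqU T U μ ν z) (F ν μ z) = F ν μ z) (x : S) :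
    divB T U (divP T U F) x = 0 := by
  have h : divP T U F = fun μ y => ∑ ν, covDstar T U ν (F ν μ) y :=
    funext fun μ => funext fun y => divP_eq_sum_of_antisymm' T U F hF μ y
  rw [h, divB]
  simp only [covDstar_sum]
  exact sum_sum_covDstar_covDstar_eq_zero T U hT F hF hcomm x

/-- **(3.117), FIRST IDENTITY: `D*J = 0`** — the current `J = D^{η*}(η⁻² Im ∂U)` of (3.11) is covariantly conserved, for an
ARBITRARY background of units on any finite lattice with commuting shifts (print derives it from the gauge invariance of `A^η`;
here it is the algebraic identity behind that: `Im U(∂p)` is odd in the orientation and commutes with `U(∂p)`). [folklore]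
[cite: Balaban1985BackgroundPropagators, (3.117) p.419] -/
theorem divB_J_eq_zero (hT : ∀ μ ν x, T μ (T ν x) = T ν (T μ x)) (η : ℝ) (x : S) : divB T U (J T U η) x = 0 := by
  have hJ : J T U η = fun μ y => ((η : ℂ)⁻¹) • divP T U (fun μ ν z => (((η : ℂ)⁻¹) ^ 2) • imC (plaqU T U μ ν z)) μ y :=
    rfl
  rw [hJ, divB_smul, divB_divP_eq_zero T U hT, smul_zero]
  · intro μ ν y
    rw [imC_plaqU_swap T U μ ν y, smul_neg]
  · intro μ ν z
    rw [R_smul, imC_plaqU_swap T U μ ν z, R_neg, R_imC_self]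

variable [Fintype S]

/-- **(3.117), FIRST IDENTITY, PAIRED FORM: `⟨Dλ, J⟩ = 0`** for every site function `λ` — (3.8) adjointness moves `D` onto `J`.
[folklore] [cite: Balaban1985BackgroundPropagators, (3.117) p.419, (3.8) p.392] -/
theorem bondPair_covDη_J (hT : ∀ μ ν x, T μ (T ν x) = T ν (T μ x)) (τ : 𝔸 →ₗ[ℂ] ℂ)
    (hτ : ∀ a b : 𝔸, τ (a * b) = τ (b * a)) (η : ℝ) (d : ℕ) (lam : S → 𝔸) :
    bondPair η d τ (covDη T U η lam) (J T U η) = 0 := by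
  simp only [bondPair, covDη_apply, smul_mul_assoc, map_smul, ← Finset.smul_sum]
  rw [sum_sum_covD_mul T U τ hτ lam (J T U η)]
  simp only [divB_J_eq_zero T U hT, mul_zero, map_zero, Finset.sum_const_zero, smul_zero, mul_zero]

end Current

/-! ## §3  (3.28)–(3.30): gauge transformations of configurations and the EXACT invariance/covariance of `A^η`, `J`, `⟨A,ΔA⟩` -/

section Gauge

variable {𝔸 : Type*} [Ring 𝔸] {S : Type*} {ι : Type*}
variable (T : ι → Equiv.Perm S) (U : ι → S → 𝔸ˣ)

/-- (3.28): the gauge transformation of a configuration, «U^u(x, x′) = u(x)U(x, x′)u⁻¹(x′)», on positive bonds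
(`U μ x = U(x, x+e_μ)`). [folklore] [cite: Balaban1985BackgroundPropagators, (3.28) p.395] -/
def gaugeTr (u : S → 𝔸ˣ) (U : ι → S → 𝔸ˣ) : ι → S → 𝔸ˣ := fun μ x => u x * U μ x * (u (T μ x))⁻¹

/-- (3.28): the rotation of a bond function, «(R(u)U′)(x, x′) = R(u(x))U′(x, x′)», here on `𝔤`-valued bond functions `A`:
`(R(u)A)(b) = R(u(b₋))A(b)`. [folklore] [cite: Balaban1985BackgroundPropagators, (3.28) p.395] -/
def rotB (u : S → 𝔸ˣ) (A : ι → S → 𝔸) : ι → S → 𝔸 := fun μ x => R (u x) (A μ x)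

/-- «(R(u)λ)(x) = R(u(x))λ(x)» on site functions ((3.31) p. 395). [folklore] [cite: Balaban1985BackgroundPropagators, (3.31) p.395] -/
def rotS (u : S → 𝔸ˣ) (lam : S → 𝔸) : S → 𝔸 := fun x => R (u x) (lam x)

/-- Unfolding `gaugeTr`: «U^u(x, x′) = u(x)U(x, x′)u⁻¹(x′)». [folklore] [cite: Balaban1985BackgroundPropagators, (3.28) p.395] -/
theorem gaugeTr_apply (u : S → 𝔸ˣ) (μ : ι) (x : S) : gaugeTr T u U μ x = u x * U μ x * (u (T μ x))⁻¹ := rfl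

/-- Unfolding `rotB`: «(R(u)A)(x, x′) = R(u(x))A(x, x′)». [folklore] [cite: Balaban1985BackgroundPropagators, (3.28) p.395] -/
@[simp] theorem rotB_apply (u : S → 𝔸ˣ) (A : ι → S → 𝔸) (μ : ι) (x : S) : rotB u A μ x = R (u x) (A μ x) := rfl

/-- Unfolding `rotS`: «(R(u)λ)(x) = R(u(x))λ(x)». [folklore] [cite: Balaban1985BackgroundPropagators, (3.31) p.395] -/
@[simp] theorem rotS_apply (u : S → 𝔸ˣ) (lam : S → 𝔸) (x : S) : rotS u lam x = R (u x) (lam x) := rfl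

/-- The trivial gauge transformation `u ≡ 1` does nothing. [folklore] [cite: Balaban1985BackgroundPropagators, (3.28) p.395] -/
@[simp] theorem gaugeTr_one : gaugeTr T (fun _ => (1 : 𝔸ˣ)) U = U := by
  funext μ x; simp [gaugeTr]

/-- **THE PLAQUETTE VARIABLE IS GAUGE COVARIANT**: `U^u(∂p) = u(x)U(∂p)u(x)⁻¹` for `p = p_{μν}(x)` — the plaquette must close,
`x + e_μ + e_ν = x + e_ν + e_μ` (commuting shifts). [folklore] [cite: Balaban1985BackgroundPropagators, (3.29) p.395] -/
theorem plaqU_gaugeTr (hT : ∀ μ ν x, T μ (T ν x) = T ν (T μ x)) (u : S → 𝔸ˣ) (μ ν : ι) (x : S) :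
    plaqU T (gaugeTr T u U) μ ν x = u x * plaqU T U μ ν x * (u x)⁻¹ := by
  simp only [plaqU, gaugeTr, mul_inv_rev, inv_inv, hT μ ν x, mul_assoc, inv_mul_cancel_left]

/-- `D_{U^u}(R(u)f) = R(u)D_U f` — the covariant gradient is covariant ((3.31) mechanism). [folklore]
[cite: Balaban1985BackgroundPropagators, (3.31) p.395] -/
theorem covD_gaugeTr (u : S → 𝔸ˣ) (μ : ι) (f : S → 𝔸) (x : S) :
    covD T (gaugeTr T u U) μ (rotS u f) x = R (u x) (covD T U μ f x) := by
  simp only [covD, gaugeTr, rotS, B9Eq39Adjoint.R_mul, R_inv_R, R_sub]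

/-- `D*_{U^u,μ}(R(u)G) = R(u)D*_{U,μ}G`. [folklore] [cite: Balaban1985BackgroundPropagators, (3.31) p.395] -/
theorem covDstar_gaugeTr (u : S → 𝔸ˣ) (μ : ι) (G : S → 𝔸) (x : S) :
    covDstar T (gaugeTr T u U) μ (rotS u G) x = R (u x) (covDstar T U μ G x) := by
  simp only [covDstar, gaugeTr, rotS, Equiv.apply_symm_apply, mul_inv_rev, inv_inv, B9Eq39Adjoint.R_mul, R_inv_R, R_sub]

/-- `(D_{U^u} R(u)A)(p) = R(u(x))(D_U A)(p)` — the covariant curl is covariant. [folklore]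
[cite: Balaban1985BackgroundPropagators, (3.30) p.395] -/
theorem curl_gaugeTr (u : S → 𝔸ˣ) (A : ι → S → 𝔸) (μ ν : ι) (x : S) :
    curl T (gaugeTr T u U) (rotB u A) μ ν x = R (u x) (curl T U A μ ν x) := by
  rw [curl, curl, R_sub]
  exact congrArg₂ (· - ·) (covD_gaugeTr T U u μ (A ν) x) (covD_gaugeTr T U u ν (A μ) x)

/-- The letters `A′(b)`, `b ⊂ ∂p`, all rotate by `R(u(x))` at the base point. [folklore]
[cite: Balaban1985BackgroundPropagators, (3.2) p.390, (3.28) p.395] -/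
theorem lettersA_gaugeTr (u : S → 𝔸ˣ) (A : ι → S → 𝔸) (μ ν : ι) (x : S) :
    lettersA T (gaugeTr T u U) (rotB u A) μ ν x = (lettersA T U A μ ν x).map (R (u x)) := by
  simp only [lettersA, gaugeTr, rotB, List.map_cons, List.map_nil, B9Eq39Adjoint.R_mul, R_inv_R, R_neg]

/-- `Σ_k R(v)a_k = R(v)Σ_k a_k` («R(u)A is linear in A», p. 395). [folklore] [cite: Balaban1985BackgroundPropagators, p.395] -/
theorem sum_map_R (v : 𝔸ˣ) (l : List 𝔸) : (l.map (R v)).sum = R v l.sum := by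
  induction l with
  | nil => simp
  | cons b l ih => rw [List.map_cons, List.sum_cons, List.sum_cons, ih, R_add]

variable [Fintype ι]

/-- `R(v)` of a finite sum («R(u)A is linear in A», p. 395). [folklore] [cite: Balaban1985BackgroundPropagators, p.395] -/
theorem R_finset_sum {α : Type*} (v : 𝔸ˣ) (s : Finset α) (f : α → 𝔸) : R v (∑ i ∈ s, f i) = ∑ i ∈ s, R v (f i) := by
  simp only [R_def, Finset.mul_sum, Finset.sum_mul]

/-- `D*_{U^u}(R(u)A) = R(u)D*_U A` — (3.8) is covariant. [folklore] [cite: Balaban1985BackgroundPropagators, (3.31) p.395] -/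
theorem divB_gaugeTr (u : S → 𝔸ˣ) (A : ι → S → 𝔸) (x : S) :
    divB T (gaugeTr T u U) (rotB u A) x = R (u x) (divB T U A x) := by
  rw [divB, divB, R_finset_sum]
  exact Finset.sum_congr rfl fun μ _ => covDstar_gaugeTr T U u μ (A μ) x

variable [LinearOrder ι]

/-- `(D*_{U^u} R(u)F)_μ(x) = R(u(x))(D*_U F)_μ(x)` — (3.9) is covariant. [folklore]
[cite: Balaban1985BackgroundPropagators, (3.30) p.395] -/
theorem divP_gaugeTr (u : S → 𝔸ˣ) (F : ι → ι → S → 𝔸) (μ : ι) (x : S) :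
    divP T (gaugeTr T u U) (fun κ ν y => R (u y) (F κ ν y)) μ x = R (u x) (divP T U F μ x) := by
  have h : ∀ κ ν, covDstar T (gaugeTr T u U) ν (fun y => R (u y) (F κ μ y)) x = R (u x) (covDstar T U ν (F κ μ) x) :=
    fun κ ν => covDstar_gaugeTr T U u ν (F κ μ) x
  have h' : ∀ κ ν, covDstar T (gaugeTr T u U) ν (fun y => R (u y) (F μ κ y)) x = R (u x) (covDstar T U ν (F μ κ) x) :=
    fun κ ν => covDstar_gaugeTr T U u ν (F μ κ) x
  rw [divP, divP, R_sub, R_finset_sum, R_finset_sum]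
  congr 1
  · refine Finset.sum_congr rfl fun ν _ => ?_
    split_ifs
    · exact h ν ν
    · exact (R_zero _).symm
  · refine Finset.sum_congr rfl fun ν _ => ?_
    split_ifs
    · exact h' ν ν
    · exact (R_zero _).symm

variable [Algebra ℂ 𝔸]

/-- `Im(vWv⁻¹) = R(v) Im W` — with `U^u(∂p) = u(x)U(∂p)u(x)⁻¹` the mechanism of «J^u = R(u)J» (3.30). [folklore]
[cite: Balaban1985BackgroundPropagators, (3.30) p.395] -/
theorem imC_conj (v W : 𝔸ˣ) : imC (v * W * v⁻¹) = R v (imC W) := by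
  rw [imC, imC, R_smul, R_def]
  congr 1
  simp only [Units.val_mul, mul_inv_rev, inv_inv, mul_sub, sub_mul, mul_assoc]

/-- `Re(vWv⁻¹) = R(v) Re W` — the mechanism of «the gauge invariance of the action (3.1)» (3.29). [folklore]
[cite: Balaban1985BackgroundPropagators, (3.29) p.395] -/
theorem reC_conj (v W : 𝔸ˣ) : reC (v * W * v⁻¹) = R v (reC W) := by
  rw [reC, reC, R_smul, R_def]
  congr 1
  simp only [Units.val_mul, mul_inv_rev, inv_inv, mul_add, add_mul, mul_assoc]

/-- **(3.30): `J^u = R(u)J`** — the current of the transformed background is the rotated current, exactly.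
[folklore] [cite: Balaban1985BackgroundPropagators, (3.30) p.395] -/
theorem J_gaugeTr (hT : ∀ μ ν x, T μ (T ν x) = T ν (T μ x)) (u : S → 𝔸ˣ) (η : ℝ) (μ : ι) (x : S) :
    J T (gaugeTr T u U) η μ x = R (u x) (J T U η μ x) := by
  have hF : (fun κ ν y => (((η : ℂ)⁻¹) ^ 2) • imC (plaqU T (gaugeTr T u U) κ ν y))
      = fun κ ν y => R (u y) ((((η : ℂ)⁻¹) ^ 2) • imC (plaqU T U κ ν y)) := by
    funext κ ν y
    rw [plaqU_gaugeTr T U hT, imC_conj, R_smul]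
  change ((η : ℂ)⁻¹) • divP T (gaugeTr T u U) (fun κ ν y => (((η : ℂ)⁻¹) ^ 2) • imC (plaqU T (gaugeTr T u U) κ ν y)) μ x
    = R (u x) (((η : ℂ)⁻¹) • divP T U (fun κ ν y => (((η : ℂ)⁻¹) ^ 2) • imC (plaqU T U κ ν y)) μ x)
  rw [hF, divP_gaugeTr, R_smul]

variable [Fintype S]

omit [LinearOrder ι] in
/-- A tracial `τ` does not see a common rotation: `⟨R(u)A, R(u)E⟩ = ⟨A, E⟩` (so (3.30) reads `J^u = R(u)J`). [folklore]
[cite: Balaban1985BackgroundPropagators, (3.30) p.395] -/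
theorem bondPair_rotB (τ : 𝔸 →ₗ[ℂ] ℂ) (hτ : ∀ a b : 𝔸, τ (a * b) = τ (b * a)) (η : ℝ) (d : ℕ) (u : S → 𝔸ˣ)
    (A E : ι → S → 𝔸) : bondPair η d τ (rotB u A) (rotB u E) = bondPair η d τ A E := by
  simp only [bondPair, rotB_apply, R_mul_R, trace_R τ hτ]

/-- **(3.30): `⟨R(u)A, J^u⟩ = ⟨A, J⟩`.** [folklore] [cite: Balaban1985BackgroundPropagators, (3.30) p.395] -/
theorem bondPair_J_gaugeTr (hT : ∀ μ ν x, T μ (T ν x) = T ν (T μ x)) (τ : 𝔸 →ₗ[ℂ] ℂ)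
    (hτ : ∀ a b : 𝔸, τ (a * b) = τ (b * a)) (η : ℝ) (d : ℕ) (u : S → 𝔸ˣ) (A : ι → S → 𝔸) :
    bondPair η d τ (rotB u A) (J T (gaugeTr T u U) η) = bondPair η d τ A (J T U η) := by
  have hJ : J T (gaugeTr T u U) η = rotB u (J T U η) := by
    funext μ x; rw [J_gaugeTr T U hT, rotB_apply]
  rw [hJ, bondPair_rotB τ hτ]

end Gauge

section GaugeNormed

variable {𝔸 : Type*} [NormedRing 𝔸] [NormedAlgebra ℂ 𝔸] [CompleteSpace 𝔸]
variable {S : Type*} [Fintype S] {ι : Type*} [Fintype ι] [LinearOrder ι]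
variable (T : ι → Equiv.Perm S) (U : ι → S → 𝔸ˣ)

omit [NormedAlgebra ℂ 𝔸] [CompleteSpace 𝔸] [Fintype S] [Fintype ι] [LinearOrder ι] in
/-- The ordered commutator sum of (3.6)/(3.10) rotates: `commSum (R(v)a_k)_k = R(v)·commSum (a_k)_k` (used for (3.30)). [folklore]
[cite: Balaban1985BackgroundPropagators, (3.30) p.395, (3.10) p.392] -/
theorem commSum_map_R (v : 𝔸ˣ) (l : List 𝔸) : commSum (l.map (R v)) = R v (commSum l) := by
  induction l with
  | nil => simp
  | cons b l ih => rw [List.map_cons, commSum_cons, commSum_cons, ih, sum_map_R, R_add, R_sub, R_mul_R, R_mul_R]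

omit [CompleteSpace 𝔸] [Fintype S] [Fintype ι] [LinearOrder ι] in
/-- The per-plaquette Wilson functional is conjugation invariant, `wil τ(vWv⁻¹) = wil τ W` — «the gauge invariance of the action
(3.1)» per plaquette. [folklore] [cite: Balaban1985BackgroundPropagators, (3.29) p.395] -/
theorem wil_conj (τ : 𝔸 →ₗ[ℂ] ℂ) (hτ : ∀ a b : 𝔸, τ (a * b) = τ (b * a)) (v W : 𝔸ˣ) :
    wil τ (v * W * v⁻¹) = wil τ W := by
  rw [wil, wil, reC_conj, trace_R τ hτ]

omit [CompleteSpace 𝔸] in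
/-- **(3.29): THE ACTION IS GAUGE INVARIANT, `A^η(U^u) = A^η(U)`**, exactly, for an arbitrary configuration of units and an
arbitrary gauge transformation `u : T → 𝔸ˣ` (complexified (3.1), tracial `τ`, commuting shifts). [folklore]
[cite: Balaban1985BackgroundPropagators, (3.29) p.395] -/
theorem action_gaugeTr (hT : ∀ μ ν x, T μ (T ν x) = T ν (T μ x)) (τ : 𝔸 →ₗ[ℂ] ℂ)
    (hτ : ∀ a b : 𝔸, τ (a * b) = τ (b * a)) (η : ℝ) (d : ℕ) (u : S → 𝔸ˣ) :
    action T η d τ (gaugeTr T u U) = action T η d τ U := by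
  simp only [action, plaqU_gaugeTr T U hT, wil_conj τ hτ]

omit [CompleteSpace 𝔸] in
/-- **(3.30): `⟨R(u)A, Δ′(U^u)R(u)A⟩ = ⟨A, Δ′(U)A⟩`** — every ingredient of (3.10) rotates by `R(u(x))` at the base point of its
plaquette and `τ` is tracial. [folklore] [cite: Balaban1985BackgroundPropagators, (3.30) p.395, (3.10) p.392] -/
theorem deltaPrime_gaugeTr (hT : ∀ μ ν x, T μ (T ν x) = T ν (T μ x)) (τ : 𝔸 →ₗ[ℂ] ℂ)
    (hτ : ∀ a b : 𝔸, τ (a * b) = τ (b * a)) (η : ℝ) (d : ℕ) (u : S → 𝔸ˣ) (A : ι → S → 𝔸) :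
    deltaPrime T (gaugeTr T u U) η d τ (rotB u A) = deltaPrime T U η d τ A := by
  rw [deltaPrime, deltaPrime]
  congr 1
  refine Finset.sum_congr rfl fun q _ => ?_
  set v := u q.1
  set W := plaqU T U q.2.1 q.2.2 q.1
  set c := curl T U A q.2.1 q.2.2 q.1
  have hW : plaqU T (gaugeTr T u U) q.2.1 q.2.2 q.1 = v * W * v⁻¹ := plaqU_gaugeTr T U hT u _ _ _
  have h1' : reC (plaqU T (gaugeTr T u U) q.2.1 q.2.2 q.1) - 1 = R v (reC W - 1) := by
    rw [hW, reC_conj, R_sub, R_apply_one]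
  have h1 : τ (curl T (gaugeTr T u U) (rotB u A) q.2.1 q.2.2 q.1 * curl T (gaugeTr T u U) (rotB u A) q.2.1 q.2.2 q.1
        * ((((η : ℂ)⁻¹) ^ 2) • (reC (plaqU T (gaugeTr T u U) q.2.1 q.2.2 q.1) - 1)))
      = τ (c * c * ((((η : ℂ)⁻¹) ^ 2) • (reC W - 1))) := by
    rw [curl_gaugeTr, h1', ← R_smul, R_mul_R, R_mul_R, trace_R τ hτ]
  have h2 : τ ((I • commSum (lettersA T (gaugeTr T u U) (rotB u A) q.2.1 q.2.2 q.1))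
        * ((((η : ℂ)⁻¹) ^ 2) • imC (plaqU T (gaugeTr T u U) q.2.1 q.2.2 q.1)))
      = τ ((I • commSum (lettersA T U A q.2.1 q.2.2 q.1)) * ((((η : ℂ)⁻¹) ^ 2) • imC W)) := by
    rw [lettersA_gaugeTr, commSum_map_R, hW, imC_conj, ← R_smul, ← R_smul, R_mul_R, trace_R τ hτ]
  rw [h1, h2]

omit [CompleteSpace 𝔸] in
/-- **(3.30): `⟨R(u)A, Δ^η(U^u)R(u)A⟩ = ⟨A, Δ^η(U)A⟩`**, i.e. `Δ^η(U^u) = R(u)Δ^η(U)R(u⁻¹)` at the level of the quadratic form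
(3.10), exactly. [folklore] [cite: Balaban1985BackgroundPropagators, (3.30) p.395] -/
theorem hessPair_gaugeTr (hT : ∀ μ ν x, T μ (T ν x) = T ν (T μ x)) (τ : 𝔸 →ₗ[ℂ] ℂ)
    (hτ : ∀ a b : 𝔸, τ (a * b) = τ (b * a)) (η : ℝ) (d : ℕ) (u : S → 𝔸ˣ) (A : ι → S → 𝔸) :
    hessPair T (gaugeTr T u U) η d τ (rotB u A) = hessPair T U η d τ A := by
  have hc : curlη T (gaugeTr T u U) η (rotB u A) = fun κ ν y => R (u y) (curlη T U η A κ ν y) := by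
    funext κ ν y; rw [curlη, curlη, curl_gaugeTr, R_smul]
  have hd : divPη T (gaugeTr T u U) η (curlη T (gaugeTr T u U) η (rotB u A)) = rotB u (divPη T U η (curlη T U η A)) := by
    funext μ x; rw [rotB_apply, divPη, divPη, hc, divP_gaugeTr, R_smul]
  rw [hessPair, hessPair, hd, bondPair_rotB τ hτ, deltaPrime_gaugeTr T U hT τ hτ]

omit [Fintype S] [Fintype ι] [LinearOrder ι] in
/-- «R(u(x)) exp iηA(x,x′) = exp iηR(u(x))A(x,x′)» (p. 395): the fluctuation field of the rotated `A` is the conjugated one.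
[folklore] [cite: Balaban1985BackgroundPropagators, p.395] -/
theorem fluct_rotB (u : S → 𝔸ˣ) (η : ℝ) (A : ι → S → 𝔸) (μ : ι) (x : S) :
    fluct η (rotB u A) μ x = u x * fluct η A μ x * (u x)⁻¹ := by
  ext
  simp only [fluct, rotB_apply, Units.val_mul, val_holU, holonomy_cons, holonomy_nil, mul_one]
  rw [← R_smul, R_def, B12Membership314.exp_units_conj']

omit [Fintype S] [Fintype ι] [LinearOrder ι] in
/-- **(3.28)–(3.29): `(R(u)U′)·U^u = (U′U)^u`** — transforming the background and rotating the fluctuation IS gauge-transforming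
the product configuration («A^η(R(u)U′U^u) = A^η((U′U)^u)», (3.29)). [folklore] [cite: Balaban1985BackgroundPropagators, (3.29) p.395] -/
theorem prodCfg_gaugeTr (u : S → 𝔸ˣ) (η : ℝ) (A : ι → S → 𝔸) :
    prodCfg (gaugeTr T u U) η (rotB u A) = gaugeTr T u (prodCfg U η A) := by
  funext μ x
  rw [prodCfg, fluct_rotB, gaugeTr_apply, gaugeTr_apply, prodCfg]
  simp only [mul_assoc, inv_mul_cancel_left]

/-- (3.29) FOR THE EXPANSION: `A^η((U′U)^u) = A^η(U′U)` with `(U′U)^u = (R(u)U′)U^u`. [folklore]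
[cite: Balaban1985BackgroundPropagators, (3.29) p.395] -/
theorem action_prodCfg_gaugeTr (hT : ∀ μ ν x, T μ (T ν x) = T ν (T μ x)) (τ : 𝔸 →ₗ[ℂ] ℂ)
    (hτ : ∀ a b : 𝔸, τ (a * b) = τ (b * a)) (η : ℝ) (d : ℕ) (u : S → 𝔸ˣ) (A : ι → S → 𝔸) :
    action T η d τ (prodCfg (gaugeTr T u U) η (rotB u A)) = action T η d τ (prodCfg U η A) := by
  rw [prodCfg_gaugeTr, action_gaugeTr T _ hT τ hτ]

end GaugeNormed

/-! ## §4  (3.116): the gauge-transformed fluctuation `U′ᵘ_b = e^{iλ(b₋)}e^{iηA(b)}e^{−iR_bλ(b₊)}` and its second-order data -/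

section BCH

variable {𝔸 : Type*} [NormedRing 𝔸] [NormedAlgebra ℂ 𝔸] [CompleteSpace 𝔸] {S : Type*} {ι : Type*}
variable (T : ι → Equiv.Perm S) (U : ι → S → 𝔸ˣ)

/-- «u = e^{iλ}» (p. 418): the gauge transformation generated by a `𝔤`-valued site function. [folklore]
[cite: Balaban1985BackgroundPropagators, p.418] -/
def expCfg (lam : S → 𝔸) : S → 𝔸ˣ := fun x => holU [I • lam x]

omit [CompleteSpace 𝔸] in
/-- «U′ → U′ᵘ» (p. 418), first line of (3.116): `U′ᵘ_b = u(b₋)U′_b R_b u⁻¹(b₊)`, `R_b u⁻¹(b₊) = U(b)u(b₊)⁻¹U(b)⁻¹` — the fluctuation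
field of the gauge-transformed product, `(U′U)^u = U′ᵘ·U` (`gaugeTr_mul`). [folklore] [cite: Balaban1985BackgroundPropagators, (3.116) p.418] -/
def gaugeFl (u : S → 𝔸ˣ) (V : ι → S → 𝔸ˣ) : ι → S → 𝔸ˣ := fun μ x => u x * V μ x * (U μ x * (u (T μ x))⁻¹ * (U μ x)⁻¹)

omit [NormedAlgebra ℂ 𝔸] [CompleteSpace 𝔸] in
/-- `(U′U)^u = U′ᵘ·U` on every positive bond. [folklore] [cite: Balaban1985BackgroundPropagators, (3.116) p.418] -/
theorem gaugeTr_mul (u : S → 𝔸ˣ) (V : ι → S → 𝔸ˣ) :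
    gaugeTr T u (fun μ x => V μ x * U μ x) = fun μ x => gaugeFl T U u V μ x * U μ x := by
  funext μ x
  simp only [gaugeTr, gaugeFl, mul_assoc, inv_mul_cancel, mul_one]

omit [NormedAlgebra ℂ 𝔸] [CompleteSpace 𝔸] in
/-- `commSum [a, b, c] = [a,b] + [a,c] + [b,c]`. [folklore] — elementary API for the three-letter data (3.116). [cite: Balaban1985BackgroundPropagators, (3.116) p.418] -/
private theorem commSum_three (a b c : 𝔸) : commSum [a, b, c] = ad a b + ad a c + ad b c := by
  simp only [commSum_cons, commSum_nil, List.sum_cons, List.sum_nil, add_zero, mul_zero, zero_mul, sub_zero, zero_add,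
    ad_apply, mul_add, add_mul]
  abel

omit [NormedAlgebra ℂ 𝔸] [CompleteSpace 𝔸] in
/-- `[a, −m] = −[a, m]`. [folklore] — elementary API for the bracket of (3.116). [cite: Balaban1985BackgroundPropagators, (3.116) p.418] -/
private theorem ad_neg_right' (a m : 𝔸) : ad a (-m) = -ad a m := by
  simp only [ad_apply, mul_neg, neg_mul, neg_sub]
  abel

/-- The three letters of `U′ᵘ_b` transported to `b₋ = x`: `iλ(x)`, `iηA(b)`, `−iR(U(b))λ(x + e_μ)`. [folklore]
[cite: Balaban1985BackgroundPropagators, (3.116) p.418] -/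
def letters3 (η : ℝ) (lam : S → 𝔸) (A : ι → S → 𝔸) (μ : ι) (x : S) : List 𝔸 :=
  [I • lam x, ((I * η : ℂ)) • A μ x, -(R (U μ x) (I • lam (T μ x)))]

/-- **(3.116), SECOND LINE**: `U′ᵘ_b = e^{iλ(b₋)} e^{iηA(b)} e^{−iR_bλ(b₊)}` for `U′ = e^{iηA}`, `u = e^{iλ}` — conjugation through
`exp` (`B12Membership314.exp_neg_units_conj'` BY NAME). [folklore] [cite: Balaban1985BackgroundPropagators, (3.116) p.418] -/
theorem gaugeFl_fluct (η : ℝ) (lam : S → 𝔸) (A : ι → S → 𝔸) (μ : ι) (x : S) :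
    gaugeFl T U (expCfg lam) (fluct η A) μ x = holU (letters3 T U η lam A μ x) := by
  ext
  simp only [gaugeFl, expCfg, fluct, letters3, Units.val_mul, val_holU, val_inv_holU, invPath_cons, invPath_nil,
    List.nil_append, holonomy_cons, holonomy_nil, mul_one]
  rw [← B12Membership314.exp_neg_units_conj', R_def]
  simp only [mul_assoc]

/-- The printed second-order term of (3.116): `½i[λ(b₋),A(b)] − ½i[A(b),R_bλ(b₊)] − ½η⁻¹i[λ(b₋),R_bλ(b₊)]`. [folklore]
[cite: Balaban1985BackgroundPropagators, (3.116) p.418] -/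
def bch2 (η : ℝ) (lam : S → 𝔸) (A : ι → S → 𝔸) (μ : ι) (x : S) : 𝔸 :=
  (2 : ℂ)⁻¹ • (I • ad (lam x) (A μ x) - I • ad (A μ x) (R (U μ x) (lam (T μ x)))
    - ((η : ℂ)⁻¹) • (I • ad (lam x) (R (U μ x) (lam (T μ x)))))

/-- The printed bracket of (3.117): `S_λ(A)(b) = i[λ(b₋),A(b)] − i[A(b),R_bλ(b₊)] − i[λ(b₋),(Dλ)(b)]` (twice `bch2`, `two_smul_bch2`).
[folklore] [cite: Balaban1985BackgroundPropagators, (3.117) p.419] -/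
def shiftJ (η : ℝ) (lam : S → 𝔸) (A : ι → S → 𝔸) : ι → S → 𝔸 := fun μ x =>
  I • ad (lam x) (A μ x) - I • ad (A μ x) (R (U μ x) (lam (T μ x))) - I • ad (lam x) (covDη T U η lam μ x)

omit [CompleteSpace 𝔸] in
/-- «−½η⁻¹i[λ(b₋),R_bλ(b₊)]» of (3.116) IS «−½i[λ(b₋),(Dλ)(b)]» of (3.117): `η⁻¹[λ(x), R(U(b))λ(x+e_μ)] = [λ(x), (D^ηλ)(b)]`
(`[λ(x),λ(x)] = 0`). [folklore] [cite: Balaban1985BackgroundPropagators, (3.116) p.418, (3.117) p.419] -/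
theorem ad_covDη (η : ℝ) (lam : S → 𝔸) (μ : ι) (x : S) :
    ad (lam x) (covDη T U η lam μ x) = ((η : ℂ)⁻¹) • ad (lam x) (R (U μ x) (lam (T μ x))) := by
  rw [covDη_apply, ad_smul_right, covD, ad_sub_right]
  simp

omit [CompleteSpace 𝔸] in
/-- `2·bch2 = S_λ(A)`. [folklore] [cite: Balaban1985BackgroundPropagators, (3.116) p.418, (3.117) p.419] -/
theorem two_smul_bch2 (η : ℝ) (lam : S → 𝔸) (A : ι → S → 𝔸) (μ : ι) (x : S) :
    (2 : ℂ) • bch2 T U η lam A μ x = shiftJ T U η lam A μ x := by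
  rw [bch2, smul_inv_smul₀ (two_ne_zero (α := ℂ)), shiftJ, ad_covDη, smul_comm]

omit [CompleteSpace 𝔸] in
/-- **(3.116), FIRST ORDER**: the letter sum is `iη(A(b) − (D^ηλ)(b))` («= A(b) − (Dλ)(b) + …»). [folklore]
[cite: Balaban1985BackgroundPropagators, (3.116) p.418] -/
theorem sum_letters3 {η : ℝ} (hη : η ≠ 0) (lam : S → 𝔸) (A : ι → S → 𝔸) (μ : ι) (x : S) :
    (letters3 T U η lam A μ x).sum = ((I * η : ℂ)) • (A μ x - covDη T U η lam μ x) := by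
  have hη' : (η : ℂ) ≠ 0 := Complex.ofReal_ne_zero.mpr hη
  simp only [letters3, List.sum_cons, List.sum_nil, add_zero, covDη_apply, covD, R_smul, smul_sub, smul_smul,
    mul_assoc, mul_inv_cancel₀ hη', mul_one]
  abel

omit [CompleteSpace 𝔸] in
/-- **(3.116), SECOND ORDER**: the ordered commutator sum of the three letters is `2iη·bch2`, i.e.
`½Σ_{j<k}[a_j,a_k] = iη(½i[λ(b₋),A(b)] − ½i[A(b),R_bλ(b₊)] − ½η⁻¹i[λ(b₋),R_bλ(b₊)])` — the second-order term of the print's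
`(1/iη) log U′ᵘ_b`, since `log P = (P − 1) − ½(P − 1)² + O(‖P − 1‖³) = Σ_k a_k + ½Σ_{j<k}[a_j,a_k] + O(3)` for `P = Π_k e^{a_k}`.
[folklore] [cite: Balaban1985BackgroundPropagators, (3.116) p.418] -/
theorem commSum_letters3 {η : ℝ} (hη : η ≠ 0) (lam : S → 𝔸) (A : ι → S → 𝔸) (μ : ι) (x : S) :
    commSum (letters3 T U η lam A μ x) = ((2 * I * η : ℂ)) • bch2 T U η lam A μ x := by
  have hη' : (η : ℂ) ≠ 0 := Complex.ofReal_ne_zero.mpr hη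
  rw [letters3, commSum_three, bch2]
  simp only [R_smul, ad_neg_right', ad_smul_left, ad_smul_right, smul_sub, smul_smul]
  match_scalars <;> field_simp

/-- **(3.116) TO SECOND ORDER, PRODUCT FORM**: `e^{iλ(b₋)}e^{iηA(b)}e^{−iR_bλ(b₊)} = 1 + iη(A − Dλ)(b) + ½[(iη(A − Dλ)(b))² + 2iη·bch2(b)] + E`
with `E` the third-order remainder of the ordered product (`B9Eq37Insertion.rem`, `‖E‖ ≤ (s³/6)e^s`, `s` = the size of the three
letters, `norm_rem_letters3_le`).  This is the print's `(1/iη) log U′ᵘ_b = A(b) − (Dλ)(b) + bch2(b) + ⋯` stated without a logarithm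
(Mathlib has none on a general Banach algebra): the first- and second-order Taylor data of `U′ᵘ_b` are those of `exp iη(A − Dλ + bch2)`.
[folklore] [cite: Balaban1985BackgroundPropagators, (3.116) p.418] -/
theorem val_gaugeFl_fluct {η : ℝ} (hη : η ≠ 0) (lam : S → 𝔸) (A : ι → S → 𝔸) (μ : ι) (x : S) :
    (gaugeFl T U (expCfg lam) (fluct η A) μ x : 𝔸)
      = 1 + ((I * η : ℂ)) • (A μ x - covDη T U η lam μ x)
        + (2 : ℂ)⁻¹ • (((I * η : ℂ)) • (A μ x - covDη T U η lam μ x) * (((I * η : ℂ)) • (A μ x - covDη T U η lam μ x))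
            + ((2 * I * η : ℂ)) • bch2 T U η lam A μ x)
        + rem (letters3 T U η lam A μ x) := by
  rw [gaugeFl_fluct, val_holU, ← sum_letters3 T U hη, ← commSum_letters3 T U hη, ← quad_eq_half, rem]
  abel

omit [NormedAlgebra ℂ 𝔸] in
/-- The remainder of (3.116) is THIRD ORDER: `‖E‖ ≤ (s³/6)e^s`, `s = ‖iλ(b₋)‖ + ‖iηA(b)‖ + ‖iR_bλ(b₊)‖` (`B9Eq37Insertion.norm_rem_le_cube`
BY NAME) — «the dots denote higher order terms» (p. 419). [folklore] [cite: Balaban1985BackgroundPropagators, (3.116) p.418, p.419] -/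
theorem norm_rem_letters3_le {𝔸 : Type*} [NormedRing 𝔸] [NormedAlgebra ℂ 𝔸] [CompleteSpace 𝔸] (U : ι → S → 𝔸ˣ)
    (η : ℝ) (lam : S → 𝔸) (A : ι → S → 𝔸) (μ : ι) (x : S) :
    ‖rem (letters3 T U η lam A μ x)‖
      ≤ size (letters3 T U η lam A μ x) ^ 3 / 6 * Real.exp (size (letters3 T U η lam A μ x)) :=
  norm_rem_le_cube _

end BCH

/-! ## §5  (3.117), second identity — the typed statement, under B9 §3's standing hypotheses (PROVED in §7, `Eq3117QuadShift_holds`) -/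

section QuadShift

variable {𝔸 : Type*} [NormedRing 𝔸] [NormedAlgebra ℂ 𝔸] [CompleteSpace 𝔸]
variable {S : Type*} [Fintype S] {ι : Type*} [Fintype ι] [LinearOrder ι]
variable (T : ι → Equiv.Perm S) (U : ι → S → 𝔸ˣ)

/-- **(3.117), SECOND IDENTITY** («⟨A − Dλ, Δ(A − Dλ)⟩ = ⟨A, ΔA⟩ − ⟨i[λ(b₋), A(b)] − i[A(b), R_bλ(b₊)] − i[λ(b₋), (Dλ)(b)], J⟩»,
p. 419: «Expanding the both sides of the identity [A^η(U′ᵘU) = A^η(U′U)] according to (3.12), and comparing terms of the same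
order»), with `⟨A,ΔA⟩` the quadratic form (3.10) (`B9Eq39Adjoint.hessPair`), `J` of (3.11), `D = D^η_U` of (3.3) and the bracket
`shiftJ`; the statement for the background `U`, scale `η`, weight exponent `d` and trace `τ` (the almost-invariance of the
quadratic form under linear gauge transformations `A → A − Dλ`; it feeds (3.118)–(3.120)), STATED UNDER THE STANDING HYPOTHESES
OF B9 §3 as antecedents — the lattice is a torus (the shifts commute, plaquettes close), «tr» is tracial, `η > 0` (`η ≠ 0`) —
exactly the setting in which p. 419 prints it (v3: the v1 typing omitted the antecedents and was thereby STRONGER than print and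
false for non-commuting shifts; no module imports the v1 constant, cf. the review of p240636).  PROVED: `Eq3117QuadShift_holds`
(closed; arbitrary background of units, every `d`). [cite: Balaban1985BackgroundPropagators, (3.117) p.419] -/
def Eq3117QuadShift (η : ℝ) (d : ℕ) (τ : 𝔸 →L[ℂ] ℂ) : Prop :=
  (∀ μ ν x, T μ (T ν x) = T ν (T μ x)) → (∀ a b : 𝔸, τ (a * b) = τ (b * a)) → η ≠ 0 →
    ∀ (A : ι → S → 𝔸) (lam : S → 𝔸),
      hessPair T U η d (τ : 𝔸 →ₗ[ℂ] ℂ) (fun μ x => A μ x - covDη T U η lam μ x)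
        = hessPair T U η d (τ : 𝔸 →ₗ[ℂ] ℂ) A - bondPair η d (τ : 𝔸 →ₗ[ℂ] ℂ) (shiftJ T U η lam A) (J T U η)

end QuadShift

/-! ## §6  Sanity examples -/

section Examples

variable {𝔸 : Type*} [Ring 𝔸] [Algebra ℂ 𝔸] {S : Type*} {ι : Type*} [Fintype ι] [LinearOrder ι]
variable (T : ι → Equiv.Perm S)

/-- At the trivial background every plaquette variable is `1`, so `Im U(∂p) = 0` and the current vanishes identically. -/
example (η : ℝ) (μ : ι) (x : S) : J T (fun (_ : ι) (_ : S) => (1 : 𝔸ˣ)) η μ x = 0 := by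
  simp [J, divPη, divP, plaqU, covDstar]

/-- A gauge transformation of the trivial background is a «pure gauge»: `U^u(b) = u(b₋)u(b₊)⁻¹`. -/
example (u : S → 𝔸ˣ) (μ : ι) (x : S) : gaugeTr T u (fun (_ : ι) (_ : S) => (1 : 𝔸ˣ)) μ x = u x * (u (T μ x))⁻¹ := by
  simp [gaugeTr]

end Examples

open Literature.MathematicalPhysics.QuantumFieldTheory.Balaban1983to89.Beta.AdjointTransportJets (invPath_append sum_inv
  commSum_append commSum_inv)

/-! ## §7  (3.117), second identity — PROOF («expanding the both sides of the identity A^η(U′ᵘU) = A^η(U′U) … and comparing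
terms of the same order», p. 419), plaquette by plaquette -/

/-! ### §7.1  Plaquette words for list-valued fluctuation data -/

section Words

variable {𝔸 : Type*} [NormedRing 𝔸] [NormedAlgebra ℂ 𝔸] [CompleteSpace 𝔸] {S : Type*} {ι : Type*}
variable (T : ι → Equiv.Perm S) (U : ι → S → 𝔸ˣ)

/-- `Π_k e^{a_k} · Π_j e^{b_j} = Π e^{(a ++ b)}` as units («(3.15)-type composition of holonomies»). [folklore]
[cite: Balaban1985BackgroundPropagators, (3.6) p.391] -/
theorem holU_append (l m : List 𝔸) : holU (l ++ m) = holU l * holU m := by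
  ext
  simp only [val_holU, Units.val_mul, holonomy, List.map_append, List.prod_append]

/-- The unit of the inverse path is the inverse unit («U(−∂p) = U(∂p)⁻¹», (3.5)). [folklore]
[cite: Balaban1985BackgroundPropagators, (3.5) p.391] -/
theorem holU_invPath (l : List 𝔸) : holU (invPath l) = (holU l)⁻¹ := by
  ext
  rw [val_holU, val_inv_holU]

/-- Transport of a whole word: `Π_k e^{R(V)a_k} = V·(Π_k e^{a_k})·V⁻¹` («R(u(x)) exp iηA = exp iηR(u(x))A», p. 395, letter by
letter). [folklore] [cite: Balaban1985BackgroundPropagators, p.395] -/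
theorem holU_map_R (V : 𝔸ˣ) (l : List 𝔸) : holU (l.map (R V)) = V * holU l * V⁻¹ := by
  induction l with
  | nil => ext; simp
  | cons a l ih =>
    have ih' : holonomy (l.map (R V)) = (V : 𝔸) * holonomy l * ((V⁻¹ : 𝔸ˣ) : 𝔸) := by
      have := congrArg Units.val ih
      simpa only [val_holU, Units.val_mul] using this
    ext
    simp only [val_holU, Units.val_mul, List.map_cons, holonomy_cons, ih', R_def, B12Membership314.exp_units_conj']
    simp only [mul_assoc, Units.inv_mul_cancel_left]

/-- THE PLAQUETTE WORD of a configuration `V·U` whose fluctuation `V(b) = Π_k e^{l_k(b)}` is an ordered product of exponentials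
on every bond: the letters of the four bonds of `∂p` in the contour order of (3.2) (`⟨z,w⟩, ⟨w,x⟩, ⟨x,y⟩, ⟨y,z⟩`), transported to
the base point and reversed on the reversed bonds — for one-letter lists it is `letters η (lettersA …)`. [folklore]
[cite: Balaban1985BackgroundPropagators, (3.1)–(3.2) p.390, (3.116) p.418] -/
def word (l : ι → S → List 𝔸) (μ ν : ι) (x : S) : List 𝔸 :=
  invPath ((l μ (T ν x)).map (R (U ν x))) ++ invPath (l ν x) ++ l μ x ++ (l ν (T μ x)).map (R (U μ x))

/-- **(3.1) FOR LIST-VALUED FLUCTUATIONS**: under a tracial `τ` the plaquette variable of `V·U`, `V(b) = Π_k e^{l_k(b)}`, may be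
replaced by `(Π over the plaquette word)·U(∂p)` — `B9Eq39Adjoint.wil_plaqU_prodCfg` is the one-letter case. [folklore]
[cite: Balaban1985BackgroundPropagators, (3.1) p.390] -/
theorem wil_plaqU_holU_mul (τ : 𝔸 →ₗ[ℂ] ℂ) (hτ : ∀ a b : 𝔸, τ (a * b) = τ (b * a)) (l : ι → S → List 𝔸)
    (μ ν : ι) (x : S) :
    wil τ (plaqU T (fun κ y => holU (l κ y) * U κ y) μ ν x) = wil τ (holU (word T U l μ ν x) * plaqU T U μ ν x) := by
  have h1 : plaqU T (fun κ y => holU (l κ y) * U κ y) μ ν x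
      = (holU (l μ x ++ (l ν (T μ x)).map (R (U μ x))) * plaqU T U μ ν x)
        * holU (invPath ((l μ (T ν x)).map (R (U ν x))) ++ invPath (l ν x)) := by
    rw [holU_append, holU_append, holU_map_R, holU_invPath, holU_invPath, holU_map_R]
    simp only [plaqU, mul_inv_rev, inv_inv, mul_assoc, inv_mul_cancel_left]
  have h2 : holU (word T U l μ ν x) * plaqU T U μ ν x
      = holU (invPath ((l μ (T ν x)).map (R (U ν x))) ++ invPath (l ν x))
        * (holU (l μ x ++ (l ν (T μ x)).map (R (U μ x))) * plaqU T U μ ν x) := by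
    rw [word, List.append_assoc, holU_append, mul_assoc]
  rw [h1, h2, wil_mul_comm τ hτ]

omit [NormedAlgebra ℂ 𝔸] [CompleteSpace 𝔸] in
/-- The letter sum of the plaquette word is the letter sum of the one-letter word of the bond sums. [folklore]
[cite: Balaban1985BackgroundPropagators, (3.4) p.391] -/
theorem sum_word (l : ι → S → List 𝔸) (μ ν : ι) (x : S) :
    (word T U l μ ν x).sum = (lettersA T U (fun κ y => (l κ y).sum) μ ν x).sum := by
  simp only [word, List.sum_append, sum_inv, sum_map_R, lettersA, List.sum_cons, List.sum_nil, add_zero]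
  abel

omit [NormedAlgebra ℂ 𝔸] [CompleteSpace 𝔸] in
/-- The ordered commutator sum of the plaquette word: the transported commutator sums of the four bonds PLUS the commutator sum
of the four bond sums (`commSum_append`, `commSum_inv`, `commSum_map_R`). [folklore] [cite: Balaban1985BackgroundPropagators, (3.6) p.391] -/
theorem commSum_word (l : ι → S → List 𝔸) (μ ν : ι) (x : S) :
    commSum (word T U l μ ν x)
      = (lettersA T U (fun κ y => commSum (l κ y)) μ ν x).sum
        + commSum (lettersA T U (fun κ y => (l κ y).sum) μ ν x) := by
  simp only [word, commSum_append, commSum_inv, commSum_map_R, List.sum_append, sum_inv, sum_map_R, lettersA,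
    List.sum_cons, List.sum_nil, add_zero, commSum_cons, commSum_nil, zero_add, mul_zero, zero_mul, sub_zero]
  noncomm_ring

omit [CompleteSpace 𝔸] in
/-- Scaling every letter scales the word. [folklore] [cite: Balaban1985BackgroundPropagators, (3.116) p.418] -/
theorem word_map_smul (c : ℂ) (l : ι → S → List 𝔸) (μ ν : ι) (x : S) :
    word T U (fun κ y => (l κ y).map (c • ·)) μ ν x = (word T U l μ ν x).map (c • ·) := by
  have hinv : ∀ m : List 𝔸, invPath (m.map (c • ·)) = (invPath m).map (c • ·) := by
    intro m; simp [invPath, List.map_reverse, List.map_map, Function.comp_def, smul_neg]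
  have hR : ∀ (V : 𝔸ˣ) (m : List 𝔸), (m.map (c • ·)).map (R V) = (m.map (R V)).map (c • ·) := by
    intro V m; simp [List.map_map, Function.comp_def, R_smul]
  simp only [word, List.map_append, hR, hinv]

omit [CompleteSpace 𝔸] in
/-- `lettersA` is linear: scaling. [folklore] [cite: Balaban1985BackgroundPropagators, (3.2) p.390] -/
theorem lettersA_smul (c : ℂ) (B : ι → S → 𝔸) (μ ν : ι) (x : S) :
    lettersA T U (fun κ y => c • B κ y) μ ν x = (lettersA T U B μ ν x).map (c • ·) := by
  simp [lettersA, R_smul, smul_neg]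

omit [CompleteSpace 𝔸] in
/-- `letters η` of a scaled word is the scaled `letters η`. [folklore] [cite: Balaban1985BackgroundPropagators, (3.2) p.390] -/
theorem letters_map_smul (η : ℝ) (c : ℂ) (L : List 𝔸) :
    letters η (L.map (c • ·)) = (letters η L).map (c • ·) := by
  simp [letters, List.map_map, Function.comp_def, smul_comm c]

omit [CompleteSpace 𝔸] in
/-- The three letters scale jointly in `(λ, A)`. [folklore] [cite: Balaban1985BackgroundPropagators, (3.116) p.418] -/
theorem letters3_smul (η : ℝ) (c : ℂ) (lam : S → 𝔸) (A : ι → S → 𝔸) (μ : ι) (x : S) :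
    letters3 T U η (fun y => c • lam y) (fun κ y => c • A κ y) μ x = (letters3 T U η lam A μ x).map (c • ·) := by
  simp [letters3, R_smul, smul_neg, smul_comm c]

end Words

/-! ### §7.2  The coefficients of the per-plaquette expansion and «comparing terms of the same order» -/

section Coefficients

variable {𝔸 : Type*} [NormedRing 𝔸] [NormedAlgebra ℂ 𝔸] [CompleteSpace 𝔸]

/-- First-order coefficient of `wil τ(P·W) − wil τ W` in the letters (`B9Eq37Insertion.wil_holonomy_mul`). [folklore]
[cite: Balaban1985BackgroundPropagators, (3.7) p.391] -/
def coef1 (τ : 𝔸 →ₗ[ℂ] ℂ) (W : 𝔸ˣ) (l : List 𝔸) : ℂ := -(I * τ (l.sum * imC W))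

/-- Second-order coefficient of `wil τ(P·W) − wil τ W` in the letters (`B9Eq37Insertion.wil_holonomy_mul`). [folklore]
[cite: Balaban1985BackgroundPropagators, (3.7) p.391] -/
def coef2 (τ : 𝔸 →ₗ[ℂ] ℂ) (W : 𝔸ˣ) (l : List 𝔸) : ℂ :=
  -(2 : ℂ)⁻¹ * τ (l.sum * l.sum * reC W) - I / 2 * τ (commSum l * imC W)

/-- The third-order remainder of `wil τ(P·W) − wil τ W` (`B9Eq37Insertion.wil_holonomy_mul`). [folklore]
[cite: Balaban1985BackgroundPropagators, (3.7) p.391] -/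
def coef3 (τ : 𝔸 →ₗ[ℂ] ℂ) (W : 𝔸ˣ) (l : List 𝔸) : ℂ :=
  -((2 : ℂ)⁻¹ * (τ (rem l * (W : 𝔸)) + τ (((W⁻¹ : 𝔸ˣ) : 𝔸) * rem (invPath l))))

/-- (3.7) per plaquette in the three coefficients. [folklore] [cite: Balaban1985BackgroundPropagators, (3.7) p.391] -/
theorem wil_holU_mul_eq (τ : 𝔸 →ₗ[ℂ] ℂ) (hτ : ∀ a b : 𝔸, τ (a * b) = τ (b * a)) (W : 𝔸ˣ) (l : List 𝔸) :
    wil τ (holU l * W) - wil τ W = coef1 τ W l + coef2 τ W l + coef3 τ W l := by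
  rw [wil_holonomy_mul τ hτ, coef1, coef2, coef3]
  ring

omit [CompleteSpace 𝔸] in
/-- The first-order coefficient is homogeneous of degree one in the letters. [folklore]
[cite: Balaban1985BackgroundPropagators, p.395, p.419] -/
theorem coef1_map_smul (τ : 𝔸 →ₗ[ℂ] ℂ) (W : 𝔸ˣ) (c : ℂ) (l : List 𝔸) :
    coef1 τ W (l.map (c • ·)) = c * coef1 τ W l := by
  simp only [coef1, sum_map_smul, smul_mul_assoc, map_smul, smul_eq_mul]
  ring

omit [CompleteSpace 𝔸] in
/-- The second-order coefficient is homogeneous of degree two in the letters. [folklore]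
[cite: Balaban1985BackgroundPropagators, p.395, p.419] -/
theorem coef2_map_smul (τ : 𝔸 →ₗ[ℂ] ℂ) (W : 𝔸ˣ) (c : ℂ) (l : List 𝔸) :
    coef2 τ W (l.map (c • ·)) = c ^ 2 * coef2 τ W l := by
  simp only [coef2, sum_map_smul, commSum_map_smul, smul_mul_assoc, mul_smul_comm, smul_smul, map_smul, smul_eq_mul]
  ring

/-- The remainder is UNIFORMLY THIRD ORDER along a ray: `‖coef3(t·l)‖ ≤ K(l)·t³` for `0 ≤ t ≤ 1` («the dots denote higher order
terms», p. 419). [folklore] [cite: Balaban1985BackgroundPropagators, p.419] -/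
theorem norm_coef3_smul_le (τ : 𝔸 →L[ℂ] ℂ) (W : 𝔸ˣ) (l : List 𝔸) {t : ℝ} (ht0 : 0 ≤ t) (ht1 : t ≤ 1) :
    ‖coef3 (τ : 𝔸 →ₗ[ℂ] ℂ) W (l.map (((t : ℂ)) • ·))‖
      ≤ (2⁻¹ * ‖τ‖ * (‖(W : 𝔸)‖ + ‖((W⁻¹ : 𝔸ˣ) : 𝔸)‖) * (size l ^ 3 / 6 * Real.exp (size l))) * t ^ 3 := by
  have h := norm_rem_le τ (l.map (((t : ℂ)) • ·)) W
  rw [coef3, norm_neg]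
  refine h.trans ?_
  have hs : size (l.map (((t : ℂ)) • ·)) = t * size l := by
    rw [size_map_smul, Complex.norm_real, Real.norm_of_nonneg ht0]
  rw [hs]
  have hsl : 0 ≤ size l := size_nonneg l
  have hts : 0 ≤ t * size l := mul_nonneg ht0 hsl
  have hK : 0 ≤ 2⁻¹ * ‖τ‖ * (‖(W : 𝔸)‖ + ‖((W⁻¹ : 𝔸ˣ) : 𝔸)‖) := by positivity
  have hexp : Real.exp (t * size l) ≤ Real.exp (size l) :=
    Real.exp_le_exp.mpr (by nlinarith)
  calc 2⁻¹ * ‖τ‖ * (‖(W : 𝔸)‖ + ‖((W⁻¹ : 𝔸ˣ) : 𝔸)‖) * expTail 3 (t * size l)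
      ≤ 2⁻¹ * ‖τ‖ * (‖(W : 𝔸)‖ + ‖((W⁻¹ : 𝔸ˣ) : 𝔸)‖) * ((t * size l) ^ 3 / 6 * Real.exp (t * size l)) :=
        mul_le_mul_of_nonneg_left (expTail_three_le hts) hK
    _ ≤ 2⁻¹ * ‖τ‖ * (‖(W : 𝔸)‖ + ‖((W⁻¹ : 𝔸ˣ) : 𝔸)‖) * ((t * size l) ^ 3 / 6 * Real.exp (size l)) := by
        gcongr
    _ = (2⁻¹ * ‖τ‖ * (‖(W : 𝔸)‖ + ‖((W⁻¹ : 𝔸ˣ) : 𝔸)‖) * (size l ^ 3 / 6 * Real.exp (size l))) * t ^ 3 := by ring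

/-- «COMPARING TERMS OF THE SAME ORDER» (p. 419), the analytic lemma: if `‖t·a + t²·b‖ ≤ K·t³` for all `0 < t ≤ 1`, then
`a = 0` and `b = 0`. [folklore] [cite: Balaban1985BackgroundPropagators, p.419, p.395] -/
theorem eq_zero_of_norm_le_cube {E : Type*} [NormedAddCommGroup E] [NormedSpace ℝ E] (a b : E) (K : ℝ)
    (h : ∀ t : ℝ, 0 < t → t ≤ 1 → ‖t • a + t ^ 2 • b‖ ≤ K * t ^ 3) : a = 0 ∧ b = 0 := by
  have hK : 0 ≤ K := by
    have h1 := h 1 one_pos le_rfl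
    have := (norm_nonneg _).trans h1
    linarith
  -- first `a = 0`
  have ha : a = 0 := by
    by_contra ha
    have hpos : 0 < ‖a‖ := norm_pos_iff.mpr ha
    set t := min 1 (‖a‖ / (2 * (K + ‖b‖ + 1))) with ht
    have hden : 0 < 2 * (K + ‖b‖ + 1) := by positivity
    have ht0 : 0 < t := lt_min one_pos (div_pos hpos hden)
    have ht1 : t ≤ 1 := min_le_left _ _
    have hta : t ≤ ‖a‖ / (2 * (K + ‖b‖ + 1)) := min_le_right _ _
    have key := h t ht0 ht1
    -- ‖t a‖ ≤ ‖t a + t² b‖ + ‖t² b‖ ≤ K t³ + t²‖b‖ ≤ t² (K + ‖b‖)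
    have h1 : t * ‖a‖ ≤ K * t ^ 3 + t ^ 2 * ‖b‖ := by
      have e : t • a = (t • a + t ^ 2 • b) - t ^ 2 • b := by abel
      have := norm_sub_le (t • a + t ^ 2 • b) (t ^ 2 • b)
      rw [← e, norm_smul, norm_smul, Real.norm_of_nonneg ht0.le, Real.norm_of_nonneg (by positivity : (0:ℝ) ≤ t ^ 2)] at this
      linarith
    have h2 : ‖a‖ ≤ t * (K + ‖b‖) := by
      have h3 : K * t ^ 3 + t ^ 2 * ‖b‖ ≤ t * (t * (K + ‖b‖)) := by
        have : t ^ 3 ≤ t ^ 2 := by nlinarith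
        nlinarith [norm_nonneg b]
      have := h1.trans h3
      exact le_of_mul_le_mul_left (by linarith) ht0
    have h4 : t * (K + ‖b‖) ≤ ‖a‖ / 2 := by
      calc t * (K + ‖b‖) ≤ ‖a‖ / (2 * (K + ‖b‖ + 1)) * (K + ‖b‖ + 1) := by
            apply mul_le_mul hta (by linarith) (by positivity) (by positivity)
        _ = ‖a‖ / 2 := by field_simp
    linarith
  refine ⟨ha, ?_⟩
  subst ha
  by_contra hb
  have hpos : 0 < ‖b‖ := norm_pos_iff.mpr hb
  set t := min 1 (‖b‖ / (2 * (K + 1))) with ht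
  have hden : 0 < 2 * (K + 1) := by positivity
  have ht0 : 0 < t := lt_min one_pos (div_pos hpos hden)
  have ht1 : t ≤ 1 := min_le_left _ _
  have htb : t ≤ ‖b‖ / (2 * (K + 1)) := min_le_right _ _
  have key := h t ht0 ht1
  rw [smul_zero, zero_add, norm_smul, Real.norm_of_nonneg (by positivity : (0:ℝ) ≤ t ^ 2)] at key
  have h2 : ‖b‖ ≤ K * t := by
    have : t ^ 2 * ‖b‖ ≤ t ^ 2 * (K * t) := by nlinarith
    exact le_of_mul_le_mul_left this (by positivity)
  have h4 : K * t ≤ ‖b‖ / 2 := by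
    calc K * t ≤ (K + 1) * (‖b‖ / (2 * (K + 1))) := by
          apply mul_le_mul (by linarith) htb ht0.le (by positivity)
      _ = ‖b‖ / 2 := by field_simp
  linarith

/-- **GAUGE INVARIANCE ALONG A RAY FIXES THE FIRST TWO COEFFICIENTS**: if two letter lists give the same Wilson functional along the
whole ray `t ↦ t·l`, `t ↦ t·m`, their first- and second-order coefficients agree (the remainders are `O(t³)`). [folklore]
[cite: Balaban1985BackgroundPropagators, p.419, p.395] -/
theorem coef_eq_of_wil_eq (τ : 𝔸 →L[ℂ] ℂ) (hτ : ∀ a b : 𝔸, τ (a * b) = τ (b * a)) (W : 𝔸ˣ) (l m : List 𝔸)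
    (h : ∀ t : ℝ, 0 < t → t ≤ 1 →
      wil (τ : 𝔸 →ₗ[ℂ] ℂ) (holU (l.map (((t : ℂ)) • ·)) * W) = wil (τ : 𝔸 →ₗ[ℂ] ℂ) (holU (m.map (((t : ℂ)) • ·)) * W)) :
    coef1 (τ : 𝔸 →ₗ[ℂ] ℂ) W l = coef1 (τ : 𝔸 →ₗ[ℂ] ℂ) W m
      ∧ coef2 (τ : 𝔸 →ₗ[ℂ] ℂ) W l = coef2 (τ : 𝔸 →ₗ[ℂ] ℂ) W m := by
  have hτ' : ∀ a b : 𝔸, (τ : 𝔸 →ₗ[ℂ] ℂ) (a * b) = (τ : 𝔸 →ₗ[ℂ] ℂ) (b * a) := by simpa using hτ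
  set Kl := 2⁻¹ * ‖τ‖ * (‖(W : 𝔸)‖ + ‖((W⁻¹ : 𝔸ˣ) : 𝔸)‖) * (size l ^ 3 / 6 * Real.exp (size l))
  set Km := 2⁻¹ * ‖τ‖ * (‖(W : 𝔸)‖ + ‖((W⁻¹ : 𝔸ˣ) : 𝔸)‖) * (size m ^ 3 / 6 * Real.exp (size m))
  have main : ∀ t : ℝ, 0 < t → t ≤ 1 →
      ‖t • (coef1 (τ : 𝔸 →ₗ[ℂ] ℂ) W l - coef1 (τ : 𝔸 →ₗ[ℂ] ℂ) W m)
        + t ^ 2 • (coef2 (τ : 𝔸 →ₗ[ℂ] ℂ) W l - coef2 (τ : 𝔸 →ₗ[ℂ] ℂ) W m)‖ ≤ (Kl + Km) * t ^ 3 := by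
    intro t ht0 ht1
    have el := wil_holU_mul_eq (τ : 𝔸 →ₗ[ℂ] ℂ) hτ' W (l.map (((t : ℂ)) • ·))
    have em := wil_holU_mul_eq (τ : 𝔸 →ₗ[ℂ] ℂ) hτ' W (m.map (((t : ℂ)) • ·))
    rw [h t ht0 ht1] at el
    rw [coef1_map_smul, coef2_map_smul] at el em
    have e : t • (coef1 (τ : 𝔸 →ₗ[ℂ] ℂ) W l - coef1 (τ : 𝔸 →ₗ[ℂ] ℂ) W m)
        + t ^ 2 • (coef2 (τ : 𝔸 →ₗ[ℂ] ℂ) W l - coef2 (τ : 𝔸 →ₗ[ℂ] ℂ) W m)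
        = coef3 (τ : 𝔸 →ₗ[ℂ] ℂ) W (m.map (((t : ℂ)) • ·)) - coef3 (τ : 𝔸 →ₗ[ℂ] ℂ) W (l.map (((t : ℂ)) • ·)) := by
      rw [Complex.real_smul, Complex.real_smul]
      push_cast
      linear_combination em - el
    rw [e]
    refine (norm_sub_le _ _).trans ?_
    have h3l : ‖coef3 (τ : 𝔸 →ₗ[ℂ] ℂ) W (l.map (((t : ℂ)) • ·))‖ ≤ Kl * t ^ 3 := norm_coef3_smul_le τ W l ht0.le ht1
    have h3m : ‖coef3 (τ : 𝔸 →ₗ[ℂ] ℂ) W (m.map (((t : ℂ)) • ·))‖ ≤ Km * t ^ 3 := norm_coef3_smul_le τ W m ht0.le ht1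
    calc _ ≤ Km * t ^ 3 + Kl * t ^ 3 := add_le_add h3m h3l
      _ = (Kl + Km) * t ^ 3 := by ring
  have := eq_zero_of_norm_le_cube _ _ _ main
  exact ⟨sub_eq_zero.mp this.1, sub_eq_zero.mp this.2⟩

end Coefficients

/-! ### §7.3  The coefficients of the one-letter words ARE `⟨A,J⟩` and `½⟨A,ΔA⟩` ((3.12)); the three-letter word shifts the
second coefficient by `⟨bch2, J⟩` -/

section Identify

variable {𝔸 : Type*} [NormedRing 𝔸] [NormedAlgebra ℂ 𝔸] [CompleteSpace 𝔸] {S : Type*} {ι : Type*}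
variable (T : ι → Equiv.Perm S) (U : ι → S → 𝔸ˣ)

omit [CompleteSpace 𝔸] in
/-- The remainder coefficient of the one-letter word is `B9Eq39Adjoint.rem3`. [folklore]
[cite: Balaban1985BackgroundPropagators, (3.12) p.392] -/
theorem coef3_letters (τ : 𝔸 →ₗ[ℂ] ℂ) (η : ℝ) (B : ι → S → 𝔸) (μ ν : ι) (x : S) :
    coef3 τ (plaqU T U μ ν x) (letters η (lettersA T U B μ ν x)) = rem3 T U η τ B μ ν x := by
  rw [coef3, rem3, neg_mul]

omit [CompleteSpace 𝔸] in
/-- The FIRST coefficient of the one-letter word is the `⟨A,J⟩`-summand of (3.11)/(3.12):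
`η^{d−4}·coef1 = η^d τ((D^η_U B)(p)·η⁻² Im U(∂p))`. [folklore] [cite: Balaban1985BackgroundPropagators, (3.11) p.392, (3.12) p.392] -/
theorem coef1_letters (τ : 𝔸 →ₗ[ℂ] ℂ) {η : ℝ} (hη : η ≠ 0) {d : ℕ} (hd : 4 ≤ d) (B : ι → S → 𝔸) (μ ν : ι) (x : S) :
    (η : ℂ) ^ (d - 4) * coef1 τ (plaqU T U μ ν x) (letters η (lettersA T U B μ ν x))
      = (η : ℂ) ^ d * τ (curlη T U η B μ ν x * ((((η : ℂ)⁻¹) ^ 2) • imC (plaqU T U μ ν x))) := by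
  have hη' : (η : ℂ) ≠ 0 := Complex.ofReal_ne_zero.mpr hη
  have hpow : (η : ℂ) ^ d = (η : ℂ) ^ (d - 4) * (η : ℂ) ^ 4 := by rw [← pow_add, Nat.sub_add_cancel hd]
  rw [coef1, sum_letters_eq, plaqD_lettersA, hpow]
  simp only [smul_mul_assoc, mul_smul_comm, map_smul, smul_eq_mul]
  field_simp
  ring_nf
  simp only [I_sq]
  ring

/-- The SECOND coefficient of the one-letter word is the `½⟨A,ΔA⟩`-summand of (3.10)/(3.12) (from `B9Eq39Adjoint.summand_split`).
[folklore] [cite: Balaban1985BackgroundPropagators, (3.10) p.392, (3.12) p.392] -/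
theorem coef2_letters (τ : 𝔸 →ₗ[ℂ] ℂ) (hτ : ∀ a b : 𝔸, τ (a * b) = τ (b * a)) {η : ℝ} (hη : η ≠ 0) {d : ℕ}
    (hd : 4 ≤ d) (B : ι → S → 𝔸) (μ ν : ι) (x : S) :
    (η : ℂ) ^ (d - 4) * coef2 τ (plaqU T U μ ν x) (letters η (lettersA T U B μ ν x))
      = 2⁻¹ * ((η : ℂ) ^ d * τ (curlη T U η B μ ν x * curlη T U η B μ ν x)
          + (η : ℂ) ^ d * (τ (curl T U B μ ν x * curl T U B μ ν x
              * ((((η : ℂ)⁻¹) ^ 2) • (reC (plaqU T U μ ν x) - 1)))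
            + τ ((I • commSum (lettersA T U B μ ν x)) * ((((η : ℂ)⁻¹) ^ 2) • imC (plaqU T U μ ν x))))) := by
  have hs := summand_split T U τ hτ η hη hd B μ ν x
  rw [wil_holU_mul_eq τ hτ, coef3_letters, mul_add, mul_add, coef1_letters T U τ hη hd] at hs
  linear_combination hs

variable [Fintype S] [Fintype ι] [LinearOrder ι]

/-- Summed over the positively oriented plaquettes the second coefficients give `½⟨B, Δ^η(U)B⟩` (3.10). [folklore]
[cite: Balaban1985BackgroundPropagators, (3.10) p.392, (3.12) p.392] -/
theorem sum_coef2_letters (τ : 𝔸 →ₗ[ℂ] ℂ) (hτ : ∀ a b : 𝔸, τ (a * b) = τ (b * a)) {η : ℝ} (hη : η ≠ 0) {d : ℕ}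
    (hd : 4 ≤ d) (B : ι → S → 𝔸) :
    ∑ q ∈ posPlaq S ι, (η : ℂ) ^ (d - 4) * coef2 τ (plaqU T U q.2.1 q.2.2 q.1) (letters η (lettersA T U B q.2.1 q.2.2 q.1))
      = 2⁻¹ * hessPair T U η d τ B := by
  rw [Finset.sum_congr rfl fun q _ => coef2_letters T U τ hτ hη hd B q.2.1 q.2.2 q.1, hessPair,
    bondPair_divPη_curlη T U τ hτ, deltaPrime]
  simp only [mul_add, Finset.mul_sum, ← Finset.sum_add_distrib]

omit [CompleteSpace 𝔸] in
/-- `⟨B, J⟩` as a plaquette sum with the weight `η^{d−4}·η` (from `B9Eq39Adjoint.bondPair_J`). [folklore]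
[cite: Balaban1985BackgroundPropagators, (3.11) p.392] -/
theorem bondPair_J_eq_sum (τ : 𝔸 →ₗ[ℂ] ℂ) (hτ : ∀ a b : 𝔸, τ (a * b) = τ (b * a)) {η : ℝ} (hη : η ≠ 0) {d : ℕ}
    (hd : 4 ≤ d) (B : ι → S → 𝔸) :
    bondPair η d τ B (J T U η)
      = ∑ q ∈ posPlaq S ι, (η : ℂ) ^ (d - 4) * ((η : ℂ) * τ (curl T U B q.2.1 q.2.2 q.1 * imC (plaqU T U q.2.1 q.2.2 q.1))) := by
  have hη' : (η : ℂ) ≠ 0 := Complex.ofReal_ne_zero.mpr hη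
  have hpow : (η : ℂ) ^ d = (η : ℂ) ^ (d - 4) * (η : ℂ) ^ 4 := by rw [← pow_add, Nat.sub_add_cancel hd]
  rw [bondPair_J T U τ hτ, Finset.mul_sum]
  refine Finset.sum_congr rfl fun q _ => ?_
  rw [curlη, hpow]
  simp only [smul_mul_assoc, mul_smul_comm, map_smul, smul_eq_mul]
  field_simp

omit [CompleteSpace 𝔸] [LinearOrder ι] in
/-- `⟨·,·⟩` is linear in its first argument: scalars. [folklore] [cite: Balaban1985BackgroundPropagators, (3.11) p.392] -/
theorem bondPair_smul_left (η : ℝ) (d : ℕ) (τ : 𝔸 →ₗ[ℂ] ℂ) (c : ℂ) (B E : ι → S → 𝔸) :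
    bondPair η d τ (fun μ x => c • B μ x) E = c * bondPair η d τ B E := by
  simp only [bondPair, smul_mul_assoc, map_smul, smul_eq_mul, Finset.mul_sum]
  refine Finset.sum_congr rfl fun x _ => Finset.sum_congr rfl fun μ _ => ?_
  ring

omit [CompleteSpace 𝔸] [Fintype S] [Fintype ι] [LinearOrder ι] in
/-- THE THREE-LETTER WORD VERSUS THE ONE-LETTER WORD OF `A − Dλ`: same letter sum, and the second coefficient is shifted by the
`bch2`-current term — `coef2(word of U′ᵘ) = coef2(word of e^{iη(A − Dλ)}) + η·τ((D_U bch2)(p)·Im U(∂p))`. [folklore]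
[cite: Balaban1985BackgroundPropagators, (3.116) p.418, (3.117) p.419] -/
theorem coef2_word_letters3 (τ : 𝔸 →ₗ[ℂ] ℂ) {η : ℝ} (hη : η ≠ 0) (lam : S → 𝔸) (A : ι → S → 𝔸) (μ ν : ι) (x : S) :
    coef2 τ (plaqU T U μ ν x) (word T U (letters3 T U η lam A) μ ν x)
      = coef2 τ (plaqU T U μ ν x) (letters η (lettersA T U (fun κ y => A κ y - covDη T U η lam κ y) μ ν x))
        + (η : ℂ) * τ (curl T U (bch2 T U η lam A) μ ν x * imC (plaqU T U μ ν x)) := by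
  have hsum : (word T U (letters3 T U η lam A) μ ν x).sum
      = (letters η (lettersA T U (fun κ y => A κ y - covDη T U η lam κ y) μ ν x)).sum := by
    rw [sum_word]
    simp only [sum_letters3 T U hη]
    rw [lettersA_smul, letters]
  have hcomm : commSum (word T U (letters3 T U η lam A) μ ν x)
      = commSum (letters η (lettersA T U (fun κ y => A κ y - covDη T U η lam κ y) μ ν x))
        + ((2 * I * η : ℂ)) • curl T U (bch2 T U η lam A) μ ν x := by
    rw [commSum_word]
    simp only [sum_letters3 T U hη, commSum_letters3 T U hη]
    rw [lettersA_smul, lettersA_smul, sum_map_smul, sum_lettersA, letters, add_comm]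
  rw [coef2, coef2, hsum, hcomm]
  simp only [add_mul, map_add, smul_mul_assoc, map_smul, smul_eq_mul]
  have hI : I * I = -1 := I_mul_I
  linear_combination (-(η : ℂ) * τ (curl T U (bch2 T U η lam A) μ ν x * imC (plaqU T U μ ν x))) * hI

end Identify

/-! ### §7.4  The second identity of (3.117), PROVED -/

section Holds

variable {𝔸 : Type*} [NormedRing 𝔸] [NormedAlgebra ℂ 𝔸] [CompleteSpace 𝔸]
variable {S : Type*} [Fintype S] {ι : Type*} [Fintype ι] [LinearOrder ι]
variable (T : ι → Equiv.Perm S) (U : ι → S → 𝔸ˣ)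

omit [Fintype S] [Fintype ι] [LinearOrder ι] in
/-- **GAUGE INVARIANCE PER PLAQUETTE ALONG THE RAY** `t ↦ (tA, tλ)`: the Wilson functional of the three-letter word of `U′ᵘ`
equals that of the one-letter word of `U′ = e^{iη tA}` — «the identity A^η(U′ᵘU) = A^η(U′U)» (p. 418), plaquette by plaquette.
[folklore] [cite: Balaban1985BackgroundPropagators, p.418, (3.29) p.395] -/
theorem wil_word_letters3_eq (hT : ∀ μ ν x, T μ (T ν x) = T ν (T μ x)) (τ : 𝔸 →ₗ[ℂ] ℂ)
    (hτ : ∀ a b : 𝔸, τ (a * b) = τ (b * a)) (η : ℝ) (lam : S → 𝔸) (A : ι → S → 𝔸) (μ ν : ι) (x : S) (t : ℂ) :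
    wil τ (holU ((word T U (letters3 T U η lam A) μ ν x).map (t • ·)) * plaqU T U μ ν x)
      = wil τ (holU ((letters η (lettersA T U A μ ν x)).map (t • ·)) * plaqU T U μ ν x) := by
  set At : ι → S → 𝔸 := fun κ y => t • A κ y with hAt
  set lt : S → 𝔸 := fun y => t • lam y with hlt
  have hw : (word T U (letters3 T U η lam A) μ ν x).map (t • ·) = word T U (letters3 T U η lt At) μ ν x := by
    rw [← word_map_smul]
    congr 1
    funext κ y
    rw [hlt, hAt, letters3_smul]
  have hl : (letters η (lettersA T U A μ ν x)).map (t • ·) = letters η (lettersA T U At μ ν x) := by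
    rw [hAt, lettersA_smul, letters_map_smul]
  have hcfg : (fun κ y => holU (letters3 T U η lt At κ y) * U κ y) = gaugeTr T (expCfg lt) (prodCfg U η At) := by
    rw [show prodCfg U η At = fun κ y => fluct η At κ y * U κ y from rfl, gaugeTr_mul]
    funext κ y
    rw [gaugeFl_fluct]
  rw [hw, hl, ← wil_plaqU_holU_mul T U τ hτ, hcfg, plaqU_gaugeTr T _ hT, wil_conj τ hτ, wil_plaqU_prodCfg T U τ hτ]

omit [Fintype S] [Fintype ι] [LinearOrder ι] in
/-- Hence, «comparing terms of the same order», the second coefficients agree plaquette by plaquette. [folklore]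
[cite: Balaban1985BackgroundPropagators, p.419] -/
theorem coef2_word_letters3_eq_coef2_letters (hT : ∀ μ ν x, T μ (T ν x) = T ν (T μ x)) (τ : 𝔸 →L[ℂ] ℂ)
    (hτ : ∀ a b : 𝔸, τ (a * b) = τ (b * a)) (η : ℝ) (lam : S → 𝔸) (A : ι → S → 𝔸) (μ ν : ι) (x : S) :
    coef2 (τ : 𝔸 →ₗ[ℂ] ℂ) (plaqU T U μ ν x) (word T U (letters3 T U η lam A) μ ν x)
      = coef2 (τ : 𝔸 →ₗ[ℂ] ℂ) (plaqU T U μ ν x) (letters η (lettersA T U A μ ν x)) := by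
  have hτ' : ∀ a b : 𝔸, (τ : 𝔸 →ₗ[ℂ] ℂ) (a * b) = (τ : 𝔸 →ₗ[ℂ] ℂ) (b * a) := by simpa using hτ
  exact (coef_eq_of_wil_eq τ hτ (plaqU T U μ ν x) _ _ fun t _ _ =>
    wil_word_letters3_eq T U hT (τ : 𝔸 →ₗ[ℂ] ℂ) hτ' η lam A μ ν x (t : ℂ)).2

omit [CompleteSpace 𝔸] in
/-- `⟨A,ΔA⟩` is homogeneous of degree `d` in the weight `η^d`. [folklore] [cite: Balaban1985BackgroundPropagators, (3.10) p.392] -/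
theorem hessPair_pow (η : ℝ) (d : ℕ) (τ : 𝔸 →ₗ[ℂ] ℂ) (B : ι → S → 𝔸) :
    hessPair T U η d τ B = (η : ℂ) ^ d * hessPair T U η 0 τ B := by
  simp only [hessPair, bondPair, deltaPrime, pow_zero, one_mul, mul_add]

omit [CompleteSpace 𝔸] [LinearOrder ι] in
/-- `⟨·,·⟩` is homogeneous of degree `d` in the weight `η^d`. [folklore] [cite: Balaban1985BackgroundPropagators, (3.11) p.392] -/
theorem bondPair_pow (η : ℝ) (d : ℕ) (τ : 𝔸 →ₗ[ℂ] ℂ) (B E : ι → S → 𝔸) :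
    bondPair η d τ B E = (η : ℂ) ^ d * bondPair η 0 τ B E := by
  simp only [bondPair, pow_zero, one_mul]

/-- THE CORE (weights `η^d`, `d ≥ 4`, so that (3.12) is available as printed). [folklore]
[cite: Balaban1985BackgroundPropagators, (3.117) p.419] -/
theorem eq3117QuadShift_of_le (hT : ∀ μ ν x, T μ (T ν x) = T ν (T μ x)) (τ : 𝔸 →L[ℂ] ℂ)
    (hτ : ∀ a b : 𝔸, τ (a * b) = τ (b * a)) {η : ℝ} (hη : η ≠ 0) {d : ℕ} (hd : 4 ≤ d) (A : ι → S → 𝔸) (lam : S → 𝔸) :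
    hessPair T U η d (τ : 𝔸 →ₗ[ℂ] ℂ) (fun μ x => A μ x - covDη T U η lam μ x)
      = hessPair T U η d (τ : 𝔸 →ₗ[ℂ] ℂ) A - bondPair η d (τ : 𝔸 →ₗ[ℂ] ℂ) (shiftJ T U η lam A) (J T U η) := by
  have hτ' : ∀ a b : 𝔸, (τ : 𝔸 →ₗ[ℂ] ℂ) (a * b) = (τ : 𝔸 →ₗ[ℂ] ℂ) (b * a) := by simpa using hτ
  -- the per-plaquette coefficient identities, weighted and summed
  have key : ∀ q : S × ι × ι,
      (η : ℂ) ^ (d - 4) * coef2 (τ : 𝔸 →ₗ[ℂ] ℂ) (plaqU T U q.2.1 q.2.2 q.1)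
          (letters η (lettersA T U (fun κ y => A κ y - covDη T U η lam κ y) q.2.1 q.2.2 q.1))
        + (η : ℂ) ^ (d - 4) * ((η : ℂ) * (τ : 𝔸 →ₗ[ℂ] ℂ)
          (curl T U (bch2 T U η lam A) q.2.1 q.2.2 q.1 * imC (plaqU T U q.2.1 q.2.2 q.1)))
      = (η : ℂ) ^ (d - 4) * coef2 (τ : 𝔸 →ₗ[ℂ] ℂ) (plaqU T U q.2.1 q.2.2 q.1) (letters η (lettersA T U A q.2.1 q.2.2 q.1)) := by
    intro q
    rw [← coef2_word_letters3_eq_coef2_letters T U hT τ hτ η lam A q.2.1 q.2.2 q.1,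
      coef2_word_letters3 T U (τ : 𝔸 →ₗ[ℂ] ℂ) hη lam A q.2.1 q.2.2 q.1, mul_add]
  have hsum := Finset.sum_congr rfl fun q (_ : q ∈ posPlaq S ι) => key q
  rw [Finset.sum_add_distrib, sum_coef2_letters T U _ hτ' hη hd, sum_coef2_letters T U _ hτ' hη hd,
    ← bondPair_J_eq_sum T U _ hτ' hη hd] at hsum
  have hshift : bondPair η d (τ : 𝔸 →ₗ[ℂ] ℂ) (shiftJ T U η lam A) (J T U η)
      = 2 * bondPair η d (τ : 𝔸 →ₗ[ℂ] ℂ) (bch2 T U η lam A) (J T U η) := by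
    rw [← bondPair_smul_left]
    congr 1
    funext κ y
    rw [two_smul_bch2]
  rw [hshift]
  linear_combination 2 * hsum

/-- **(3.117), SECOND IDENTITY — PROVED** for every weight exponent `d` (homogeneity in `η^d` transfers the core from `d + 4`):
`⟨A − Dλ, Δ(A − Dλ)⟩ = ⟨A, ΔA⟩ − ⟨i[λ(b₋),A(b)] − i[A(b),R_bλ(b₊)] − i[λ(b₋),(Dλ)(b)], J⟩` for an arbitrary background of units on
a finite lattice with commuting shifts, a continuous tracial `τ`, `η ≠ 0` — derived as in print from the gauge invariance (3.29),
the expansion (3.12) (`B9Eq39Adjoint.eq312`'s per-plaquette form) and the second-order data (3.116) of `U′ᵘ`, comparing the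
`t`- and `t²`-coefficients along `t ↦ (tA, tλ)`.  THE DISCHARGE of the named fact `Eq3117QuadShift` (closed: the
parameters `T, U, η, d, τ` of the fact and nothing else; the standing hypotheses are the fact's own antecedents). [folklore]
[cite: Balaban1985BackgroundPropagators, (3.117) p.419] -/
theorem Eq3117QuadShift_holds (η : ℝ) (d : ℕ) (τ : 𝔸 →L[ℂ] ℂ) : Eq3117QuadShift T U η d τ := by
  intro hT hτ hη A lam
  have hη' : (η : ℂ) ≠ 0 := Complex.ofReal_ne_zero.mpr hη
  have h4 := eq3117QuadShift_of_le T U hT τ hτ hη (d := d + 4) (by omega) A lam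
  rw [hessPair_pow T U η (d + 4), hessPair_pow T U η (d + 4) _ A, bondPair_pow η (d + 4)] at h4
  rw [hessPair_pow T U η d, hessPair_pow T U η d _ A, bondPair_pow η d]
  have h0 : hessPair T U η 0 (τ : 𝔸 →ₗ[ℂ] ℂ) (fun μ x => A μ x - covDη T U η lam μ x)
      = hessPair T U η 0 (τ : 𝔸 →ₗ[ℂ] ℂ) A - bondPair η 0 (τ : 𝔸 →ₗ[ℂ] ℂ) (shiftJ T U η lam A) (J T U η) := by
    have hne : (η : ℂ) ^ (d + 4) ≠ 0 := pow_ne_zero _ hη'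
    apply mul_left_cancel₀ hne
    rw [h4]
    ring
  rw [h0]
  ring

end Holds

/-! ### §7.5  (3.119)–(3.120): the gauge-invariant extension `Δ_π` and its defect `Δ′_π`, as a COROLLARY of (3.117) -/

section DeltaPi

variable {𝔸 : Type*} [NormedRing 𝔸] [NormedAlgebra ℂ 𝔸] [CompleteSpace 𝔸]
variable {S : Type*} [Fintype S] {ι : Type*} [Fintype ι] [LinearOrder ι]
variable (T : ι → Equiv.Perm S) (U : ι → S → 𝔸ˣ)

/-- (3.119): «⟨A, Δ_πA⟩ = ⟨A − DG′RD*A, Δ(A − DG′RD*A)⟩» — the quadratic form (3.10) evaluated at `A − D(PA)`, for a map `P`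
from bond functions to site functions (print: `P = G′RD*`; kept abstract here, the identity below holds for every `P`).
[folklore] [cite: Balaban1985BackgroundPropagators, (3.119) p.419] -/
def hessPi (η : ℝ) (d : ℕ) (τ : 𝔸 →ₗ[ℂ] ℂ) (P : (ι → S → 𝔸) → S → 𝔸) (A : ι → S → 𝔸) : ℂ :=
  hessPair T U η d τ (fun μ x => A μ x - covDη T U η (P A) μ x)

/-- (3.120): «⟨A, Δ′_πA⟩ := ⟨i[(G′RD*A)(b₋), A(b)] − i[A(b), R_b(G′RD*A)(b₊)] − i[(G′RD*A)(b₋), (DG′RD*A)(b)], J⟩» — the bracket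
`shiftJ` of (3.117) at `λ = PA`, paired with the current. [folklore] [cite: Balaban1985BackgroundPropagators, (3.120) p.419] -/
def deltaPiPrime (η : ℝ) (d : ℕ) (τ : 𝔸 →ₗ[ℂ] ℂ) (P : (ι → S → 𝔸) → S → 𝔸) (A : ι → S → 𝔸) : ℂ :=
  bondPair η d τ (shiftJ T U η (P A) A) (J T U η)

/-- **(3.120), PROVED**: «⟨A, Δ_πA⟩ = ⟨A, ΔA⟩ − ⟨i[(G′RD*A)(b₋), A(b)] − … , J⟩ = ⟨A, ΔA⟩ − ⟨A, Δ′_πA⟩» — the second identity of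
(3.117) at `λ = PA` («Let us now apply the second identity (3.117) to the right-hand side of (3.119)», p. 419); for every `P`.
[folklore] [cite: Balaban1985BackgroundPropagators, (3.120) p.419] -/
theorem eq3120 (hT : ∀ μ ν x, T μ (T ν x) = T ν (T μ x)) (τ : 𝔸 →L[ℂ] ℂ) (hτ : ∀ a b : 𝔸, τ (a * b) = τ (b * a))
    {η : ℝ} (hη : η ≠ 0) (d : ℕ) (P : (ι → S → 𝔸) → S → 𝔸) (A : ι → S → 𝔸) :
    hessPi T U η d (τ : 𝔸 →ₗ[ℂ] ℂ) P A = hessPair T U η d (τ : 𝔸 →ₗ[ℂ] ℂ) A - deltaPiPrime T U η d (τ : 𝔸 →ₗ[ℂ] ℂ) P A :=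
  Eq3117QuadShift_holds T U η d τ hT hτ hη A (P A)

end DeltaPi

/-! ### §7.6  (3.31): the covariant Laplace operator is gauge covariant, `Δ^η_{U^u} = R(u)Δ^η_U R(u⁻¹)`, exactly -/

section Lap

variable {𝔸 : Type*} [Ring 𝔸] [Algebra ℂ 𝔸] {S : Type*} {ι : Type*} [Fintype ι]
variable (T : ι → Equiv.Perm S) (U : ι → S → 𝔸ˣ)

/-- **(3.31)**: «⟨R(u)λ, Δ^η_{U^u}R(u)λ⟩ = ⟨λ, Δ^η_Uλ⟩, hence Δ^η_{U^u} = R(u)Δ^η_U R(u⁻¹)» — in operator form on the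
`𝔤`-valued site functions (`B9Eq352ScalarFluct.siteLap` = (3.23)), exactly, for an arbitrary background of units: no
commutation of shifts needed (no plaquette closes). [folklore] [cite: Balaban1985BackgroundPropagators, (3.31) p.395] -/
theorem siteLap_gaugeTr (u : S → 𝔸ˣ) (η : ℝ) (lam : S → 𝔸) (x : S) :
    B9Eq352ScalarFluct.siteLap T (gaugeTr T u U) η (rotS u lam) x = R (u x) (B9Eq352ScalarFluct.siteLap T U η lam x) := by
  have h : ∀ μ, covDstar T (gaugeTr T u U) μ (covD T (gaugeTr T u U) μ (rotS u lam)) x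
      = R (u x) (covDstar T U μ (covD T U μ lam) x) := by
    intro μ
    have hc : covD T (gaugeTr T u U) μ (rotS u lam) = rotS u (covD T U μ lam) := by
      funext y; rw [covD_gaugeTr, rotS_apply]
    rw [hc, covDstar_gaugeTr]
  simp only [B9Eq352ScalarFluct.siteLap, h, ← R_finset_sum, R_smul]

end Lap

/-! ### §7.7  (3.30), operator form: `Δ^η(U^u) = R(u)Δ^η(U)R(u⁻¹)` for THE OPERATOR `B9Eq310Hermitian.deltaOp` of (3.10) -/

section OpCov

variable {𝔸 : Type*} [Ring 𝔸] [Algebra ℂ 𝔸] {S : Type*} {ι : Type*}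
variable (T : ι → Equiv.Perm S) (U : ι → S → 𝔸ˣ)

/-- `z^{U^u}(p) = R(u(x)) z^U(p)` (`z(p) = η⁻²(Re U(∂p) − 1)`). [folklore] [cite: Balaban1985BackgroundPropagators, (3.30) p.395] -/
theorem zP_gaugeTr (hT : ∀ μ ν x, T μ (T ν x) = T ν (T μ x)) (u : S → 𝔸ˣ) (η : ℝ) (μ ν : ι) (x : S) :
    B9Eq310Hermitian.zP T (gaugeTr T u U) η μ ν x = R (u x) (B9Eq310Hermitian.zP T U η μ ν x) := by
  rw [B9Eq310Hermitian.zP, B9Eq310Hermitian.zP, plaqU_gaugeTr T U hT, reC_conj, R_smul, R_sub, R_apply_one]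

/-- `y^{U^u}(p) = R(u(x)) y^U(p)` (`y(p) = η⁻² Im U(∂p)`). [folklore] [cite: Balaban1985BackgroundPropagators, (3.30) p.395] -/
theorem yP_gaugeTr (hT : ∀ μ ν x, T μ (T ν x) = T ν (T μ x)) (u : S → 𝔸ˣ) (η : ℝ) (μ ν : ι) (x : S) :
    B9Eq310Hermitian.yP T (gaugeTr T u U) η μ ν x = R (u x) (B9Eq310Hermitian.yP T U η μ ν x) := by
  rw [B9Eq310Hermitian.yP, B9Eq310Hermitian.yP, plaqU_gaugeTr T U hT, imC_conj, R_smul]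

/-- The Jordan-symmetrised first-term plaquette function is covariant. [folklore]
[cite: Balaban1985BackgroundPropagators, (3.30) p.395] -/
theorem jordanF_gaugeTr (hT : ∀ μ ν x, T μ (T ν x) = T ν (T μ x)) (u : S → 𝔸ˣ) (η : ℝ) (A : ι → S → 𝔸) (μ ν : ι)
    (x : S) : B9Eq310Hermitian.jordanF T (gaugeTr T u U) η (rotB u A) μ ν x
      = R (u x) (B9Eq310Hermitian.jordanF T U η A μ ν x) := by
  rw [B9Eq310Hermitian.jordanF, B9Eq310Hermitian.jordanF, curl_gaugeTr, zP_gaugeTr T U hT, R_smul, R_add,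
    R_mul_R, R_mul_R]

omit [Algebra ℂ 𝔸] in
/-- The signed partner sums `S_k` rotate by `R(u(x))`. [folklore] [cite: Balaban1985BackgroundPropagators, (3.30) p.395] -/
theorem sgnSum_gaugeTr (u : S → 𝔸ˣ) (A : ι → S → 𝔸) (μ ν : ι) (x : S) :
    B9Eq310Hermitian.sgnSum₁ T (gaugeTr T u U) (rotB u A) μ ν x = R (u x) (B9Eq310Hermitian.sgnSum₁ T U A μ ν x)
    ∧ B9Eq310Hermitian.sgnSum₂ T (gaugeTr T u U) (rotB u A) μ ν x = R (u x) (B9Eq310Hermitian.sgnSum₂ T U A μ ν x)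
    ∧ B9Eq310Hermitian.sgnSum₃ T (gaugeTr T u U) (rotB u A) μ ν x = R (u x) (B9Eq310Hermitian.sgnSum₃ T U A μ ν x)
    ∧ B9Eq310Hermitian.sgnSum₄ T (gaugeTr T u U) (rotB u A) μ ν x = R (u x) (B9Eq310Hermitian.sgnSum₄ T U A μ ν x) := by
  simp only [B9Eq310Hermitian.sgnSum₁, B9Eq310Hermitian.sgnSum₂, B9Eq310Hermitian.sgnSum₃, B9Eq310Hermitian.sgnSum₄,
    gaugeTr, rotB, B9Eq39Adjoint.R_mul, R_inv_R, R_neg, R_add, R_sub, and_self]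

/-- The commutator letter functions `G_k(p) = (i/2)[y(p), S_k(p)]` are covariant. [folklore]
[cite: Balaban1985BackgroundPropagators, (3.30) p.395] -/
theorem commG_gaugeTr (hT : ∀ μ ν x, T μ (T ν x) = T ν (T μ x)) (u : S → 𝔸ˣ) (η : ℝ) (A : ι → S → 𝔸) (μ ν : ι)
    (x : S) :
    B9Eq310Hermitian.commG₁ T (gaugeTr T u U) η (rotB u A) μ ν x = R (u x) (B9Eq310Hermitian.commG₁ T U η A μ ν x)
    ∧ B9Eq310Hermitian.commG₂ T (gaugeTr T u U) η (rotB u A) μ ν x = R (u x) (B9Eq310Hermitian.commG₂ T U η A μ ν x)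
    ∧ B9Eq310Hermitian.commG₃ T (gaugeTr T u U) η (rotB u A) μ ν x = R (u x) (B9Eq310Hermitian.commG₃ T U η A μ ν x)
    ∧ B9Eq310Hermitian.commG₄ T (gaugeTr T u U) η (rotB u A) μ ν x = R (u x) (B9Eq310Hermitian.commG₄ T U η A μ ν x) := by
  obtain ⟨h₁, h₂, h₃, h₄⟩ := sgnSum_gaugeTr T U u A μ ν x
  simp only [B9Eq310Hermitian.commG₁, B9Eq310Hermitian.commG₂, B9Eq310Hermitian.commG₃, B9Eq310Hermitian.commG₄,
    h₁, h₂, h₃, h₄, yP_gaugeTr T U hT, R_smul, R_sub, R_mul_R, and_self]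

variable [Fintype ι] [LinearOrder ι]

omit [Algebra ℂ 𝔸] in
/-- The letter divergence `÷(G₁,…,G₄)` of `B9Eq310Hermitian.divL` is covariant: rotating all four plaquette functions by
`R(u(·))` at their base points rotates `÷` by `R(u(x))` at the bond's base point. [folklore]
[cite: Balaban1985BackgroundPropagators, (3.30) p.395] -/
theorem divL_gaugeTr (u : S → 𝔸ˣ) (G₁ G₂ G₃ G₄ : ι → ι → S → 𝔸) (μ : ι) (x : S) :
    B9Eq310Hermitian.divL T (gaugeTr T u U) (fun κ ν y => R (u y) (G₁ κ ν y)) (fun κ ν y => R (u y) (G₂ κ ν y))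
        (fun κ ν y => R (u y) (G₃ κ ν y)) (fun κ ν y => R (u y) (G₄ κ ν y)) μ x
      = R (u x) (B9Eq310Hermitian.divL T U G₁ G₂ G₃ G₄ μ x) := by
  rw [B9Eq310Hermitian.divL, B9Eq310Hermitian.divL, R_sub, R_finset_sum, R_finset_sum]
  congr 1
  · refine Finset.sum_congr rfl fun ν _ => ?_
    split_ifs
    · simp only [gaugeTr, Equiv.apply_symm_apply, mul_inv_rev, inv_inv, B9Eq39Adjoint.R_mul, R_inv_R, R_sub]
    · exact (R_zero _).symm
  · refine Finset.sum_congr rfl fun ν _ => ?_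
    split_ifs
    · simp only [gaugeTr, Equiv.apply_symm_apply, mul_inv_rev, inv_inv, B9Eq39Adjoint.R_mul, R_inv_R, R_sub]
    · exact (R_zero _).symm

/-- **`Δ′(U^u) R(u) = R(u) Δ′(U)`** for the operator `B9Eq310Hermitian.deltaPrimeOp` of (3.10). [folklore]
[cite: Balaban1985BackgroundPropagators, (3.30) p.395] -/
theorem deltaPrimeOp_gaugeTr (hT : ∀ μ ν x, T μ (T ν x) = T ν (T μ x)) (u : S → 𝔸ˣ) (η : ℝ) (A : ι → S → 𝔸)
    (μ : ι) (x : S) :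
    B9Eq310Hermitian.deltaPrimeOp T (gaugeTr T u U) η (rotB u A) μ x
      = R (u x) (B9Eq310Hermitian.deltaPrimeOp T U η A μ x) := by
  have hJ : B9Eq310Hermitian.jordanF T (gaugeTr T u U) η (rotB u A)
      = fun κ ν y => R (u y) (B9Eq310Hermitian.jordanF T U η A κ ν y) := by
    funext κ ν y; exact jordanF_gaugeTr T U hT u η A κ ν y
  have hG₁ : B9Eq310Hermitian.commG₁ T (gaugeTr T u U) η (rotB u A)
      = fun κ ν y => R (u y) (B9Eq310Hermitian.commG₁ T U η A κ ν y) := by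
    funext κ ν y; exact (commG_gaugeTr T U hT u η A κ ν y).1
  have hG₂ : B9Eq310Hermitian.commG₂ T (gaugeTr T u U) η (rotB u A)
      = fun κ ν y => R (u y) (B9Eq310Hermitian.commG₂ T U η A κ ν y) := by
    funext κ ν y; exact (commG_gaugeTr T U hT u η A κ ν y).2.1
  have hG₃ : B9Eq310Hermitian.commG₃ T (gaugeTr T u U) η (rotB u A)
      = fun κ ν y => R (u y) (B9Eq310Hermitian.commG₃ T U η A κ ν y) := by
    funext κ ν y; exact (commG_gaugeTr T U hT u η A κ ν y).2.2.1
  have hG₄ : B9Eq310Hermitian.commG₄ T (gaugeTr T u U) η (rotB u A)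
      = fun κ ν y => R (u y) (B9Eq310Hermitian.commG₄ T U η A κ ν y) := by
    funext κ ν y; exact (commG_gaugeTr T U hT u η A κ ν y).2.2.2
  rw [B9Eq310Hermitian.deltaPrimeOp, B9Eq310Hermitian.deltaPrimeOp, hJ, hG₁, hG₂, hG₃, hG₄, divP_gaugeTr, divL_gaugeTr,
    R_add]

/-- **(3.30), OPERATOR FORM: `Δ^η(U^u) = R(u)Δ^η(U)R(u⁻¹)`**, i.e. `Δ^η(U^u)(R(u)A) = R(u)(Δ^η(U)A)` bond by bond, for THE
OPERATOR `B9Eq310Hermitian.deltaOp` of (3.10) («… or J^u = R(u)J, Δ^η(U^u) = R(u)Δ^η(U)R(u⁻¹)», p. 395); any background of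
units, commuting shifts. [folklore] [cite: Balaban1985BackgroundPropagators, (3.30) p.395] -/
theorem deltaOp_gaugeTr (hT : ∀ μ ν x, T μ (T ν x) = T ν (T μ x)) (u : S → 𝔸ˣ) (η : ℝ) (A : ι → S → 𝔸) (μ : ι)
    (x : S) :
    B9Eq310Hermitian.deltaOp T (gaugeTr T u U) η (rotB u A) μ x = R (u x) (B9Eq310Hermitian.deltaOp T U η A μ x) := by
  have hc : curlη T (gaugeTr T u U) η (rotB u A) = fun κ ν y => R (u y) (curlη T U η A κ ν y) := by
    funext κ ν y; simp only [curlη, curl_gaugeTr, R_smul]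
  rw [B9Eq310Hermitian.deltaOp, B9Eq310Hermitian.deltaOp, hc, divPη, divPη, divP_gaugeTr, deltaPrimeOp_gaugeTr T U hT,
    R_add, R_smul]

end OpCov

end Literature.MathematicalPhysics.QuantumFieldTheory.Balaban1983to89.B9Eq3117Current
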